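import Literature.Probability.LatticeModels.FieldCurrentsKappa3Bound
import Literature.Probability.LatticeModels.FieldCurrentsClusterSize
import Literature.Probability.LatticeModels.FieldCurrentsDepletion
import Literature.Probability.LatticeModels.AFBetaDerivativeKernelBoundTorus
import Literature.Probability.LatticeModels.MagnetizationExponentUpperAFeR
import HarnessLib

/-!
# Aizenman–Fernández 1986, Theorem 5.7(b) on the torus from Theorem 5.6: the upper bound `δ ≤ 3` for `d > 4`

Topic `Probability/LatticeModels`, namespace `Literature.Probability.LatticeModels`. The assembly
of the random-current proof of Aizenman–Fernández's differential inequality (1.16)/(5.33) for the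
periodic Ising model, in the restricted form required by
`spontaneousMagnetization_le_sqrt_of_torusShapeR` (`MagnetizationExponentUpperAFeR`), from

* the depletion formula for `u₃` (`FieldCurrentsDepletion`, (3.18)/(5.34)),
* the second-order expansion in the scaled couplings of the bonds of the cluster of `0`
  (`CouplingPathCalculus`, (5.37)–(5.43), scaling in place of the random dilution (5.46)),
* Proposition 5.2 summed over `x` (`FieldCurrentsKappa3Bound`, (5.4), (5.50)),
* Lemma 5.3 (`FieldCurrentsClusterSize`, (5.48)),
* the bound on the weights `R` through ghost-avoiding currents (`FieldCurrentsR2Bound`, replacing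
  the printed (5.49)–(5.51), which do not follow from Lemma 5.4 as stated),
* and **Theorem 5.6** ((5.19)) as a hypothesis, in the form proved on the torus from an abstract
  random-walk kernel in `AFBetaDerivativeKernelBoundTorus` (`torusDbeta_ge_of_kernel`).

Main results: `torusU3_le_of_torusDbeta` (the restricted shape
`ū₃ ≤ -κ (βh) χ⁴` on `{2B̄βh ≤ M ≤ 33 βh χ}` below `β_c` on large tori, given (5.19)) and
`spontaneousMagnetization_le_sqrt_of_af56Torus`: (5.19) on the tori for `d ≥ 5` implies
`spontaneousMagnetization_le_sqrt` (`M(β) ≤ C (β - β_c)^{1/2}`, `d > 4`).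

## References

* M. Aizenman, R. Fernández, J. Stat. Phys. **44** (1986) 393–454, §5.2, Thm. 5.6 (5.19)–(5.20),
  Thm. 5.7 (5.33)–(5.53), pp. 431–441; §1, (1.16) and Cor. "δ = 3" [AizenmanFernandezJSP1986]
  (held: author copy `paper:url-b8cebc3f44bb`).
* M. Aizenman, D. Barsky, R. Fernández, J. Stat. Phys. **47** (1987) 343 (the extrapolation
  principles used downstream) [AizenmanBarskyFernandezJSP1987].
* R. Fernández, J. Fröhlich, A. Sokal, *Random Walks, Critical Phenomena, and Triviality in
  Quantum Field Theory*, Springer 1992, §14.4.2 [FernandezFrohlichSokalSpringer1992].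
-/

noncomputable section

open Finset MeasureTheory
open scoped symmDiff ENNReal

namespace Literature.Probability.LatticeModels

section TorusAF57

variable {d L : ℕ} [NeZero L]

local notation "𝕋" => TorusSite d L
local notation "GT" => torusGraph d L
local notation "Gg" => ghostGraph (torusGraph d L) (Finset.univ : Finset (TorusSite d L))
local notation "Λg" => Finset.insertNone (Finset.univ : Finset (TorusSite d L))
local notation "Eg" => edgesIn (ghostGraph (torusGraph d L) (Finset.univ : Finset (TorusSite d L)))
  (Finset.insertNone (Finset.univ : Finset (TorusSite d L)))
local notation "Conn[" m ", " u ", " v "]" =>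
  CConn (ghostGraph (torusGraph d L) (Finset.univ : Finset (TorusSite d L)))
    (Finset.insertNone (Finset.univ : Finset (TorusSite d L))) m
    (edgesIn (ghostGraph (torusGraph d L) (Finset.univ : Finset (TorusSite d L)))
      (Finset.insertNone (Finset.univ : Finset (TorusSite d L)))) u v
local notation "𝒮[" m ", " b "]" =>
  clusterCompl (ghostGraph (torusGraph d L) (Finset.univ : Finset (TorusSite d L)))
    (Finset.insertNone (Finset.univ : Finset (TorusSite d L))) m b
local notation "PS[" θ ", " X ", " F "]" => currentPairSum (torusGraph d L) (Finset.univ : Finset (TorusSite d L)) θ X ∅ F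
local notation "ZT[" θ "]" =>
  gcurrentZ (ghostGraph (torusGraph d L) (Finset.univ : Finset (TorusSite d L)))
    (Finset.insertNone (Finset.univ : Finset (TorusSite d L))) θ
    (edgesIn (ghostGraph (torusGraph d L) (Finset.univ : Finset (TorusSite d L)))
      (Finset.insertNone (Finset.univ : Finset (TorusSite d L)))) ∅

/-! ### The depletion functional and `-ū₃` -/

variable (d L) in
/-- **The depletion functional** `D(m) = ∑_y (M - ⟨σ_y⟩_{C^c_m(0)})` of a current configuration
(Aizenman–Fernández 1986, (5.34): "the effect on `⟨σ_y⟩` of turning off the pair couplings along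
the bonds of the cluster `C_{n₁+n₂}(0)`", summed over `y`). [cite: AizenmanFernandezJSP1986, §5.2, eq. (5.34), p. 435] -/
def depletionSum (β h : ℝ) (m : Eg → ℕ) : ℝ :=
  ∑ y : 𝕋, (isingCorr GT univ β h .free {y} - depMag GT β h (𝒮[m, some 0]) y)

/-- `D(m) ≥ 0` (Griffiths). [cite: AizenmanFernandezJSP1986, §5.2, (i) after (5.36), p. 436] -/
theorem depletionSum_nonneg {β h : ℝ} (hβ : 0 ≤ β) (hh : 0 ≤ h) (m : Eg → ℕ) : 0 ≤ depletionSum d L β h m :=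
  sum_nonneg fun y _ => sub_nonneg.2 (depMag_le hβ hh (clusterCompl_subset _ _) y (mem_univ y))

/-- **`-ū₃` as a double current with the depletion functional** (Aizenman–Fernández 1986, (5.34)
summed over the two free spins): for `β, h ≥ 0`,
`-ū₃,L(β,h) · Z² = 2 ∑_x ∑_{∂n₁ = ({0}Δ{x})*, ∂n₂ = ∅} w w 𝟙[0 ↮ g] D(n₁ + n₂)`. [cite: AizenmanFernandezJSP1986, §3.4, Cor. 3.7, eq. (3.18), p. 415, and §5.2, eq. (5.34), p. 435] -/
theorem neg_torusU3_eq {β h : ℝ} (hβ : 0 ≤ β) (hh : 0 ≤ h) :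
    -torusU3 d L β h =
      2 * (∑ x : 𝕋, (PS[ghostCoupling β (β * h), starSet ({(0 : 𝕋)} ∆ {x}),
        fun m => ind (¬Conn[m, some 0, none]) * ENNReal.ofReal (depletionSum d L β h m)]).toReal) /
        (ZT[ghostCoupling β (β * h)]).toReal ^ 2 := by
  classical
  set θ : Sym2 (Option 𝕋) → ℝ := ghostCoupling β (β * h) with hθdef
  have hθ : ∀ e, 0 ≤ θ e := fun e => ghostCoupling_nonneg hβ (mul_nonneg hβ hh) e
  -- `u₃` in `isingCorr` form
  have hcorr : ∀ (A : Finset 𝕋), isingCorr GT univ β h .plus A = isingCorr GT univ β h .free A :=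
    isingCorr_torus_plus_eq_free β h
  have hE3 : ∀ y z : 𝕋, isingExpect GT univ β h .plus (fun σ => spinAt 0 σ * spinAt y σ * spinAt z σ) =
      isingCorr GT univ β h .free ({(0 : 𝕋)} ∆ ({y} ∆ {z})) := by
    intro y z
    rw [← hcorr, isingCorr]
    congr 1; funext σ
    rw [← spinProduct_singleton (0 : 𝕋), ← spinProduct_singleton y, ← spinProduct_singleton z,
      spinProduct_mul_spinProduct, spinProduct_mul_spinProduct, symmDiff_assoc]
  have hE2 : ∀ y z : 𝕋, isingExpect GT univ β h .plus (fun σ => spinAt y σ * spinAt z σ) =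
      isingCorr GT univ β h .free ({y} ∆ {z}) := by
    intro y z
    rw [← hcorr, isingCorr]
    congr 1; funext σ
    rw [← spinProduct_singleton y, ← spinProduct_singleton z, spinProduct_mul_spinProduct]
  have hE1 : ∀ y : 𝕋, isingExpect GT univ β h .plus (spinAt y) = isingCorr GT univ β h .free {y} := by
    intro y; rw [← hcorr, isingCorr, spinProduct_singleton]
  -- the summands
  set A : 𝕋 → 𝕋 → ℝ := fun x y => (PS[θ, starSet ({(0 : 𝕋)} ∆ {x}),
    fun m => ind (¬Conn[m, some 0, none]) *
      ENNReal.ofReal (isingCorr GT univ β h .free {y} - depMag GT β h (𝒮[m, some 0]) y)]).toReal with hA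
  set Z : ℝ := (ZT[θ]).toReal with hZ
  have hu3 : ∀ y z : 𝕋,
      isingExpect GT univ β h .plus (fun σ => spinAt 0 σ * spinAt y σ * spinAt z σ) -
        isingExpect GT univ β h .plus (fun σ => spinAt 0 σ * spinAt y σ) * isingExpect GT univ β h .plus (spinAt z) -
        isingExpect GT univ β h .plus (fun σ => spinAt 0 σ * spinAt z σ) * isingExpect GT univ β h .plus (spinAt y) -
        isingExpect GT univ β h .plus (fun σ => spinAt y σ * spinAt z σ) * isingExpect GT univ β h .plus (spinAt 0) +
        2 * (isingExpect GT univ β h .plus (spinAt 0) * isingExpect GT univ β h .plus (spinAt y) *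
          isingExpect GT univ β h .plus (spinAt z)) = -((A y z + A z y) / Z ^ 2) := by
    intro y z
    rw [hE3, hE2, hE2, hE2, hE1, hE1, hE1]
    exact isingU3_eq_neg_depletion hβ hh (mem_univ _) (mem_univ _) (mem_univ _)
  unfold torusU3
  simp_rw [hu3]
  have hsum : (∑ y : 𝕋, ∑ z : 𝕋, -((A y z + A z y) / Z ^ 2)) = -(2 * (∑ y : 𝕋, ∑ z : 𝕋, A y z) / Z ^ 2) := by
    simp only [Finset.sum_neg_distrib, ← Finset.sum_div, Finset.sum_add_distrib]
    rw [show (∑ y : 𝕋, ∑ z : 𝕋, A z y) = ∑ y : 𝕋, ∑ z : 𝕋, A y z from sum_comm]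
    ring
  rw [hsum, neg_neg]
  -- `∑_z A y z = PS[θ, {0,y}*, 𝟙[0 ↮ g] D]`
  have hinner : ∀ y : 𝕋, ∑ z : 𝕋, A y z = (PS[θ, starSet ({(0 : 𝕋)} ∆ {y}),
      fun m => ind (¬Conn[m, some 0, none]) * ENNReal.ofReal (depletionSum d L β h m)]).toReal := by
    intro y
    simp only [hA]
    rw [← ENNReal.toReal_sum (fun z _ => currentPairSum_depMag_ne_top' hβ hh z), ← currentPairSum_finset_sum]
    congr 1
    refine currentPairSum_congr fun n₁ n₂ _ _ => ?_
    rw [← mul_sum, depletionSum, ENNReal.ofReal_sum_of_nonneg (fun z _ =>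
      sub_nonneg.2 (depMag_le hβ hh (clusterCompl_subset _ _) z (mem_univ z)))]
  rw [sum_congr rfl fun y _ => hinner y]
where
  /-- finiteness of the summands -/
  currentPairSum_depMag_ne_top' {β h : ℝ} (hβ : 0 ≤ β) (hh : 0 ≤ h) {y : 𝕋} (z : 𝕋) :
      (PS[ghostCoupling β (β * h), starSet ({(0 : 𝕋)} ∆ {y}),
        fun m => ind (¬Conn[m, some 0, none]) *
          ENNReal.ofReal (isingCorr GT univ β h .free {z} - depMag GT β h (𝒮[m, some 0]) z)]) ≠ ∞ := by
    refine currentPairSum_ne_top (fun e => ghostCoupling_nonneg hβ (mul_nonneg hβ hh) e) _ _ fun m => ?_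
    refine le_trans (mul_le_mul' (ind_le_one _) ?_) (by rw [one_mul])
    refine ENNReal.ofReal_le_one.2 ?_
    linarith [depMag_nonneg (G := GT) hβ hh (𝒮[m, some 0]) z, isingCorr_le_one' (G := GT) univ β h .free {z}]

/-! ### The first-order term: the size of the ghost-avoiding cluster (Lemma 5.3) -/

open Classical in
/-- **The cluster size as a sum of indicators.** [folklore] -/
theorem ofReal_clusterCard_eq (m : Eg → ℕ) :
    ENNReal.ofReal (((univ.filter fun u : 𝕋 => Conn[m, some 0, some u]).card : ℝ)) =
      ∑ u : 𝕋, ind (Conn[m, some 0, some u]) := by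
  classical
  rw [Finset.card_eq_sum_ones, Nat.cast_sum, Finset.sum_filter, ENNReal.ofReal_sum_of_nonneg (fun u _ => by
    split_ifs <;> norm_num)]
  refine sum_congr rfl fun u _ => ?_
  by_cases h : Conn[m, some 0, some u]
  · rw [if_pos h, ind_of_true h]; simp
  · rw [if_neg h, ind_of_false h]; simp

open Classical in
/-- **Summing the first-order term**: for `c ≥ 0`,
`∑_x ∑_{({0}Δ{x})*,∅} w w 𝟙[0 ↮ g] · c |C(0)| = c ∑_x ∑_u ∑ w w 𝟙[0 ↮ g] 𝟙[0 ↔ u]`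
(the right-hand side is `c Z² ∑_{u,x} T(0,u,x)`, (5.44)). [cite: AizenmanFernandezJSP1986, §5.2, eqs. (5.42), (5.44), (5.47), pp. 438–439] -/
theorem sum_currentPairSum_clusterCard_eq {β h : ℝ} (hβ : 0 ≤ β) (hh : 0 ≤ h) {c : ℝ} (hc : 0 ≤ c) :
    ∑ x : 𝕋, (PS[ghostCoupling β (β * h), starSet ({(0 : 𝕋)} ∆ {x}),
        fun m => ind (¬Conn[m, some 0, none]) *
          ENNReal.ofReal (c * ((univ.filter fun u : 𝕋 => Conn[m, some 0, some u]).card : ℝ))]).toReal =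
      c * ∑ x : 𝕋, ∑ u : 𝕋, (PS[ghostCoupling β (β * h), starSet ({(0 : 𝕋)} ∆ {x}),
        fun m => ind (¬Conn[m, some 0, none]) * ind (Conn[m, some 0, some u])]).toReal := by
  classical
  have hθ : ∀ e, 0 ≤ (ghostCoupling β (β * h) : Sym2 (Option 𝕋) → ℝ) e :=
    fun e => ghostCoupling_nonneg hβ (mul_nonneg hβ hh) e
  rw [mul_sum]
  refine sum_congr rfl fun x _ => ?_
  have hpt : ∀ m : Eg → ℕ, ind (¬Conn[m, some 0, none]) *
      ENNReal.ofReal (c * ((univ.filter fun u : 𝕋 => Conn[m, some 0, some u]).card : ℝ)) =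
      ENNReal.ofReal c * ∑ u : 𝕋, ind (¬Conn[m, some 0, none]) * ind (Conn[m, some 0, some u]) := by
    intro m
    rw [ENNReal.ofReal_mul hc, ofReal_clusterCard_eq, mul_sum, mul_sum, mul_sum]
    exact sum_congr rfl fun u _ => by ring
  simp_rw [hpt]
  rw [currentPairSum_mul_left, currentPairSum_finset_sum, ENNReal.toReal_mul, ENNReal.toReal_ofReal hc,
    ENNReal.toReal_sum (fun u _ => currentPairSum_ne_top hθ _ _ fun m =>
      le_trans (mul_le_mul' (ind_le_one _) (ind_le_one _)) (by rw [one_mul]))]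

/-! ### The second-order term: the weights `R₂` -/

open Classical in
/-- **Summing the second-order term**: for a nonnegative weight `W(u,k)`,
`∑_x ∑ w w 𝟙[0 ↮ g] ∑_{u,k} W(u,k) 𝟙[0 ↔ u] 𝟙[0 ↔ k] = ∑_{u,k} W(u,k) · Z² ∑_x R₂(0,x;u,k)`
and `∑_x R₂(0,x;u,k) ≤ ⟨σ_kσ_u⟩₀ [G♭(u,0) M/(βh) + G♭(0,k) M/(βh)]` (`sum_afR2_le`). [cite: AizenmanFernandezJSP1986, §5.2, eqs. (5.43), (5.45), (5.49)–(5.51), pp. 438–441] -/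
theorem sum_currentPairSum_weight_le {β h : ℝ} (hβ : 0 < β) (hh : 0 < h) {W : 𝕋 → 𝕋 → ℝ} (hW : ∀ u k, 0 ≤ W u k) :
    ∑ x : 𝕋, (PS[ghostCoupling β (β * h), starSet ({(0 : 𝕋)} ∆ {x}),
        fun m => ind (¬Conn[m, some 0, none]) *
          ENNReal.ofReal (∑ u : 𝕋, ∑ k : 𝕋, W u k *
            (if Conn[m, some 0, some u] ∧ Conn[m, some 0, some k] then 1 else 0))]).toReal ≤
      (ZT[ghostCoupling β (β * h)]).toReal ^ 2 *
        ∑ u : 𝕋, ∑ k : 𝕋, W u k * (isingCorr GT univ β 0 .free ({k} ∆ {u}) *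
          ((gAvoidZ GT univ (ghostCoupling β (β * h)) u 0).toReal / (ZT[ghostCoupling β (β * h)]).toReal *
              (isingCorr GT univ β h .free {k} / (β * h)) +
            (gAvoidZ GT univ (ghostCoupling β (β * h)) 0 k).toReal / (ZT[ghostCoupling β (β * h)]).toReal *
              (isingCorr GT univ β h .free {u} / (β * h)))) := by
  classical
  set θ : Sym2 (Option 𝕋) → ℝ := ghostCoupling β (β * h) with hθdef
  have hθ : ∀ e, 0 ≤ θ e := fun e => ghostCoupling_nonneg hβ.le (mul_nonneg hβ.le hh.le) e
  set Z : ℝ := (ZT[θ]).toReal with hZ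
  have hZpos : 0 < Z := toReal_gcurrentZ_ghost_empty_pos subset_rfl hθ subset_rfl
  -- pointwise linearity
  have hpt : ∀ m : Eg → ℕ, ind (¬Conn[m, some 0, none]) *
      ENNReal.ofReal (∑ u : 𝕋, ∑ k : 𝕋, W u k * (if Conn[m, some 0, some u] ∧ Conn[m, some 0, some k] then 1 else 0)) =
      ∑ u : 𝕋, ∑ k : 𝕋, ENNReal.ofReal (W u k) *
        (ind (¬Conn[m, some 0, none]) * (ind (Conn[m, some 0, some u]) * ind (Conn[m, some 0, some k]))) := by
    intro m
    rw [ENNReal.ofReal_sum_of_nonneg (fun u _ => sum_nonneg fun k _ => mul_nonneg (hW u k) (by split_ifs <;> norm_num)),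
      mul_sum]
    refine sum_congr rfl fun u _ => ?_
    rw [ENNReal.ofReal_sum_of_nonneg (fun k _ => mul_nonneg (hW u k) (by split_ifs <;> norm_num)), mul_sum]
    refine sum_congr rfl fun k _ => ?_
    rw [ENNReal.ofReal_mul (hW u k)]
    by_cases huk : Conn[m, some 0, some u] ∧ Conn[m, some 0, some k]
    · rw [if_pos huk, ind_of_true huk.1, ind_of_true huk.2]; simp; ring
    · rw [if_neg huk]
      rcases not_and_or.1 huk with h1 | h2
      · rw [ind_of_false h1]; simp
      · rw [ind_of_false h2]; simp
  have hfin : ∀ (x u k : 𝕋), PS[θ, starSet ({(0 : 𝕋)} ∆ {x}),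
      fun m => ind (¬Conn[m, some 0, none]) * (ind (Conn[m, some 0, some u]) * ind (Conn[m, some 0, some k]))] ≠ ∞ :=
    fun x u k => currentPairSum_ne_top hθ _ _ fun m =>
      le_trans (mul_le_mul' (ind_le_one _) (mul_le_mul' (ind_le_one _) (ind_le_one _))) (by simp)
  have hlin : ∀ x : 𝕋, (PS[θ, starSet ({(0 : 𝕋)} ∆ {x}),
      fun m => ind (¬Conn[m, some 0, none]) *
        ENNReal.ofReal (∑ u : 𝕋, ∑ k : 𝕋, W u k * (if Conn[m, some 0, some u] ∧ Conn[m, some 0, some k] then 1 else 0))]).toReal =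
      ∑ u : 𝕋, ∑ k : 𝕋, W u k * (PS[θ, starSet ({(0 : 𝕋)} ∆ {x}),
        fun m => ind (¬Conn[m, some 0, none]) * (ind (Conn[m, some 0, some u]) * ind (Conn[m, some 0, some k]))]).toReal := by
    intro x
    simp_rw [hpt]
    rw [currentPairSum_finset_sum, ENNReal.toReal_sum (fun u _ => ?_)]
    · refine sum_congr rfl fun u _ => ?_
      rw [currentPairSum_finset_sum, ENNReal.toReal_sum (fun k _ => ?_)]
      · refine sum_congr rfl fun k _ => ?_
        rw [currentPairSum_mul_left, ENNReal.toReal_mul, ENNReal.toReal_ofReal (hW u k)]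
      · rw [currentPairSum_mul_left]; exact ENNReal.mul_ne_top ENNReal.ofReal_ne_top (hfin x u k)
    · rw [currentPairSum_finset_sum]
      exact (ENNReal.sum_lt_top.2 fun k _ => by
        rw [currentPairSum_mul_left]; exact (ENNReal.mul_ne_top ENNReal.ofReal_ne_top (hfin x u k)).lt_top).ne
  simp_rw [hlin]
  set P : 𝕋 → 𝕋 → 𝕋 → ℝ := fun x u k => (PS[θ, starSet ({(0 : 𝕋)} ∆ {x}),
    fun m => ind (¬Conn[m, some 0, none]) * (ind (Conn[m, some 0, some u]) * ind (Conn[m, some 0, some k]))]).toReal with hP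
  set R : 𝕋 → 𝕋 → ℝ := fun u k => isingCorr GT univ β 0 .free ({k} ∆ {u}) *
    ((gAvoidZ GT univ θ u 0).toReal / Z * (isingCorr GT univ β h .free {k} / (β * h)) +
      (gAvoidZ GT univ θ 0 k).toReal / Z * (isingCorr GT univ β h .free {u} / (β * h))) with hR
  have hRx : ∀ u k : 𝕋, ∑ x : 𝕋, P x u k ≤ Z ^ 2 * R u k := by
    intro u k
    have h1 := sum_afR2_le (G := GT) (Λ := univ) hβ hh (o := 0) (u := u) (k := k) (mem_univ _) (mem_univ _) (mem_univ _)
    rw [← sum_div, div_le_iff₀ (pow_pos hZpos 2)] at h1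
    simp only [hP, starSet_pair]
    linarith
  calc ∑ x : 𝕋, ∑ u : 𝕋, ∑ k : 𝕋, W u k * P x u k
      = ∑ u : 𝕋, ∑ k : 𝕋, W u k * ∑ x : 𝕋, P x u k := by
        rw [sum_comm]
        refine sum_congr rfl fun u _ => ?_
        rw [sum_comm]
        exact sum_congr rfl fun k _ => by rw [mul_sum]
    _ ≤ ∑ u : 𝕋, ∑ k : 𝕋, W u k * (Z ^ 2 * R u k) :=
        sum_le_sum fun u _ => sum_le_sum fun k _ => mul_le_mul_of_nonneg_left (hRx u k) (hW u k)
    _ = Z ^ 2 * ∑ u : 𝕋, ∑ k : 𝕋, W u k * R u k := by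
        rw [mul_sum]
        refine sum_congr rfl fun u _ => ?_
        rw [mul_sum]
        exact sum_congr rfl fun k _ => by ring

/-! ### The depleted magnetisation as a correlation of a `θ`-system with bonds switched off -/

/-- **`⟨σ_y⟩_{C^c(0)} = ⟨σ_y⟩_{θ 𝟙_{ℰ_S}}`**: the depleted magnetisation (`depMag`) of `S = 𝒮_0 ∋ g`
is the one-point function of the `θ`-system with every bond not inside `S` switched off
(Aizenman–Fernández's convention after (3.10)). [cite: AizenmanFernandezJSP1986, §3.3, Lemma 3.2, eq. (3.10), and conventions after it, p. 411] -/
theorem depMag_eq_thetaCorr_cplOff {β h : ℝ} (hβ : 0 ≤ β) (hh : 0 ≤ h) {S : Finset (Option 𝕋)}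
    (hn : (none : Option 𝕋) ∈ S) (y : 𝕋) :
    depMag GT β h S y = thetaCorr GT univ (cplOff (ghostCoupling β (β * h)) (Eg \ edgesIn Gg S)) {y} := by
  have hθ : ∀ e, 0 ≤ (ghostCoupling β (β * h) : Sym2 (Option 𝕋) → ℝ) e :=
    fun e => ghostCoupling_nonneg hβ (mul_nonneg hβ hh) e
  have hS : S ⊆ Λg := fun v _ => by
    cases v with
    | none => exact Finset.mem_insertNone.2 (by simp)
    | some a => exact Finset.some_mem_insertNone.2 (mem_univ a)
  rw [thetaCorr_cplOff_eq_gcurrentZ_div hθ hS (subset_univ {y})]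
  by_cases hy : (some y : Option 𝕋) ∈ S
  · rw [gcurrentZ_inner_single_eq hβ hh hS hn hy, ENNReal.toReal_mul,
      ENNReal.toReal_ofReal (depMag_nonneg hβ hh S y), mul_div_assoc,
      div_self (toReal_gcurrentZ_inner_empty_pos hθ hS).ne', mul_one]
  · rw [depMag_of_not_mem hy, starSet_singleton,
      gcurrentZ_inner_eq_zero_of_not_mem _ (A := ({some y} ∆ {none} : Finset (Option 𝕋)))
        (by rw [mem_symmDiff]; exact Or.inl ⟨mem_singleton_self _, fun h' => Option.some_ne_none y (mem_singleton.1 h')⟩) hy]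
    simp

/-! ### Translation invariance of the `β`-derivative functional -/

/-- **Translation covariance of the torus correlations**: `⟨σ_{A+t}⟩ = ⟨σ_A⟩`. [cite: FriedliVelenik2017, §3.1 (periodic boundary condition, translation invariance)] -/
theorem thetaCorr_torus_map_add (β h : ℝ) (t : 𝕋) (A : Finset 𝕋) :
    thetaCorr GT univ (ghostCoupling β (β * h)) (A.map (Equiv.addRight t).toEmbedding) =
      thetaCorr GT univ (ghostCoupling β (β * h)) A := by
  rw [thetaCorr_ghostCoupling, thetaCorr_ghostCoupling]
  have key := isingCorr_free_map (G := GT) (G' := GT) (Equiv.addRight t).toEmbedding (Λ := univ)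
    (fun x _ y _ => torusGraph_adj_add_right t x y) β h A
  rw [Finset.map_univ_equiv] at key
  exact key

/-- Neighbourhoods are translates of the neighbourhood of `0`. [cite: FriedliVelenik2017, §3.1 (periodic boundary condition)] -/
theorem filter_adj_eq_map (a : 𝕋) :
    univ.filter ((torusGraph d L).Adj a) = (univ.filter ((torusGraph d L).Adj (0 : 𝕋))).map (Equiv.addRight a).toEmbedding := by
  ext v
  simp only [mem_filter, mem_univ, true_and, mem_map, Equiv.coe_toEmbedding, Equiv.coe_addRight]
  constructor
  · intro hv; exact ⟨v - a, (torusGraph_adj_iff_sub a v).1 hv, sub_add_cancel v a⟩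
  · rintro ⟨w, hw, rfl⟩; rw [torusGraph_adj_iff_sub, add_sub_cancel_right]; exact hw

/-- Translation covariance of the summand `⟨σ_y; σ_aσ_b⟩`. [cite: FriedliVelenik2017, §3.1 (translation invariance)] -/
theorem thetaTrunc3_torus_add (β h : ℝ) (y a b t : 𝕋) :
    thetaCorr GT univ (ghostCoupling β (β * h)) ({y + t} ∆ ({a + t} ∆ {b + t})) -
        thetaCorr GT univ (ghostCoupling β (β * h)) {y + t} * thetaCorr GT univ (ghostCoupling β (β * h)) ({a + t} ∆ {b + t}) =
      thetaCorr GT univ (ghostCoupling β (β * h)) ({y} ∆ ({a} ∆ {b})) -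
        thetaCorr GT univ (ghostCoupling β (β * h)) {y} * thetaCorr GT univ (ghostCoupling β (β * h)) ({a} ∆ {b}) := by
  have hinj := (Equiv.addRight t).toEmbedding.injective
  have e1 : ({y + t} ∆ ({a + t} ∆ {b + t}) : Finset 𝕋) = ({y} ∆ ({a} ∆ {b}) : Finset 𝕋).map (Equiv.addRight t).toEmbedding := by
    rw [map_eq_image, image_symmDiff _ _ hinj, image_singleton, image_symmDiff _ _ hinj, image_singleton, image_singleton]; rfl
  have e2 : ({y + t} : Finset 𝕋) = ({y} : Finset 𝕋).map (Equiv.addRight t).toEmbedding := by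
    rw [map_singleton]; rfl
  have e3 : ({a + t} ∆ {b + t} : Finset 𝕋) = ({a} ∆ {b} : Finset 𝕋).map (Equiv.addRight t).toEmbedding := by
    rw [map_eq_image, image_symmDiff _ _ hinj, image_singleton, image_singleton]; rfl
  rw [e1, e2, e3, thetaCorr_torus_map_add, thetaCorr_torus_map_add, thetaCorr_torus_map_add]

set_option maxHeartbeats 800000 in
/-- **`∑_{v ∼ u} ∑_y ⟨σ_y; σ_uσ_v⟩ = 2 ∂M/∂β` for every `u`** (translation invariance; the
identity behind (5.12) and "½∑_{y,v} J_{uv}⟨σ_y,σ_uσ_v⟩ = ∂M/∂β … independently of `u`", p. 439). [cite: AizenmanFernandezJSP1986, §5.2, proof of Thm. 5.7, display before (5.47), p. 439] -/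
theorem sum_adj_sum_trunc_eq_two_mul_torusDbeta (β h : ℝ) (u : 𝕋) :
    ∑ v ∈ univ.filter ((torusGraph d L).Adj u), ∑ y : 𝕋,
        (thetaCorr GT univ (ghostCoupling β (β * h)) ({y} ∆ ({u} ∆ {v})) -
          thetaCorr GT univ (ghostCoupling β (β * h)) {y} * thetaCorr GT univ (ghostCoupling β (β * h)) ({u} ∆ {v})) =
      2 * torusDbeta d L β h := by
  classical
  set f : 𝕋 → 𝕋 → 𝕋 → ℝ := fun y a b =>
    thetaCorr GT univ (ghostCoupling β (β * h)) ({y} ∆ ({a} ∆ {b})) -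
      thetaCorr GT univ (ghostCoupling β (β * h)) {y} * thetaCorr GT univ (ghostCoupling β (β * h)) ({a} ∆ {b}) with hf
  have hcov : ∀ y a b t : 𝕋, f (y + t) (a + t) (b + t) = f y a b := fun y a b t => thetaTrunc3_torus_add β h y a b t
  -- left-hand side: `∑_{w ∼ 0} ∑_y f y 0 w`
  have hL : ∑ b ∈ univ.filter ((torusGraph d L).Adj u), ∑ y : 𝕋, f y u b =
      ∑ w ∈ univ.filter ((torusGraph d L).Adj (0 : 𝕋)), ∑ y : 𝕋, f y 0 w := by
    rw [filter_adj_eq_map u, sum_map]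
    refine sum_congr rfl fun w _ => ?_
    simp only [Equiv.coe_toEmbedding, Equiv.coe_addRight]
    rw [← Equiv.sum_comp (Equiv.addRight u) (fun y => f y u (w + u))]
    refine sum_congr rfl fun y _ => ?_
    have := hcov y 0 w u
    rw [zero_add] at this
    exact this
  -- right-hand side: `∑_a ∑_{b ∼ a} f 0 a b = ∑_a ∑_{w ∼ 0} f (-a) 0 w`
  have hR : ∀ a : 𝕋, ∑ b ∈ univ.filter ((torusGraph d L).Adj a), f 0 a b =
      ∑ w ∈ univ.filter ((torusGraph d L).Adj (0 : 𝕋)), f (-a) 0 w := by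
    intro a
    rw [filter_adj_eq_map a, sum_map]
    refine sum_congr rfl fun w _ => ?_
    simp only [Equiv.coe_toEmbedding, Equiv.coe_addRight]
    have := hcov (-a) 0 w a
    rw [neg_add_cancel, zero_add] at this
    exact this
  change ∑ b ∈ univ.filter ((torusGraph d L).Adj u), ∑ y : 𝕋, f y u b = 2 * torusDbeta d L β h
  rw [hL, torusDbeta_eq_sum_thetaCorr]
  change _ = 2 * ((1 / 2) * ∑ a : 𝕋, ∑ b ∈ univ.filter ((torusGraph d L).Adj a), f 0 a b)
  rw [sum_congr rfl fun a _ => hR a, sum_comm,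
    ← Equiv.sum_comp (Equiv.neg 𝕋) (fun y => ∑ w ∈ univ.filter ((torusGraph d L).Adj (0 : 𝕋)), f y 0 w)]
  simp only [Equiv.neg_apply]
  rw [sum_comm]
  ring

/-! ### The pointwise lower bound on the depletion functional (the dilution step) -/

omit [NeZero L] in
/-- `cplAt` is nonnegative for `θ ≥ 0`, `t ≥ 0`. [folklore] -/
theorem cplAt_nonneg_all {θ : Sym2 (Option 𝕋) → ℝ} (hθ : ∀ e, 0 ≤ θ e) (B : Finset (Sym2 (Option 𝕋))) {t : ℝ} (ht : 0 ≤ t) :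
    ∀ e, 0 ≤ cplAt θ B t e := by
  intro e; unfold cplAt; split_ifs
  · exact mul_nonneg ht (hθ e)
  · exact hθ e

omit [NeZero L] in
/-- `cplAt ≤ θ` for `θ ≥ 0`, `t ≤ 1`. [folklore] -/
theorem cplAt_le_all {θ : Sym2 (Option 𝕋) → ℝ} (hθ : ∀ e, 0 ≤ θ e) (B : Finset (Sym2 (Option 𝕋))) {t : ℝ} (ht : t ≤ 1) :
    ∀ e, cplAt θ B t e ≤ θ e := by
  intro e; unfold cplAt; split_ifs
  · exact mul_le_of_le_one_left (hθ e) ht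
  · exact le_rfl

variable (d L) in
open Classical in
/-- **The bonds of the cluster of `0`**: the lattice bonds with an endpoint connected to `0`
(Aizenman–Fernández's `C_{n₁+n₂}(0)` read as a set of bonds, (5.36); we include every bond
touching the cluster, which is what the lower bound `𝟙[{u,v} ∈ C(0)] ≥ 𝟙[0 ↔ u]` uses). [cite: AizenmanFernandezJSP1986, §5.2, eqs. (5.36), (5.39), pp. 436–437] -/
def clusterBonds (m : Eg → ℕ) : Finset (Sym2 𝕋) :=
  (edgesIn GT univ).filter fun e => ∃ u, u ∈ e ∧ Conn[m, some 0, some u]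

/-- `clusterBonds m ⊆ ℰ`. [folklore] -/
theorem clusterBonds_subset (m : Eg → ℕ) : clusterBonds d L m ⊆ edgesIn GT univ := by
  classical
  unfold clusterBonds; exact filter_subset _ _

variable (d L) in
/-- **The pair weight `Ξ`** bounding the summed third cumulants of the diluted systems
(`sum_thetaK3_le`), written as a sum over the ordered pairs representing the two bonds:
`Ξ(e,e') = ∑_{(u,v) : {u,v} = e} ∑_{(k,l) : {k,l} = e'} 12 M (M/(βh) + 1) ∑_{b∈{u,v},c∈{k,l}} ⟨σ_bσ_c⟩_{h=0}`. [cite: AizenmanFernandezJSP1986, §5.1, Prop. 5.2, eq. (5.4), and §5.2, (5.50)–(5.51)] -/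
def afXi (β h : ℝ) (e e' : Sym2 𝕋) : ℝ :=
  ∑ u : 𝕋, ∑ v ∈ univ.filter ((torusGraph d L).Adj u), ∑ k : 𝕋, ∑ l ∈ univ.filter ((torusGraph d L).Adj k),
    if s(u, v) = e ∧ s(k, l) = e' then
      12 * torusMag d L β h * (torusMag d L β h / (β * h) + 1) *
        (isingTorusTwoPoint d L β 0 u k + isingTorusTwoPoint d L β 0 u l +
          isingTorusTwoPoint d L β 0 v k + isingTorusTwoPoint d L β 0 v l)
    else 0

/-- The cross-link factor is nonnegative. [folklore] -/
theorem afXi_summand_nonneg {β h : ℝ} (hβ : 0 ≤ β) (hh : 0 ≤ h) (u v k l : 𝕋) :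
    0 ≤ 12 * torusMag d L β h * (torusMag d L β h / (β * h) + 1) *
        (isingTorusTwoPoint d L β 0 u k + isingTorusTwoPoint d L β 0 u l +
          isingTorusTwoPoint d L β 0 v k + isingTorusTwoPoint d L β 0 v l) := by
  have hM := torusMag_nonneg (d := d) (L := L) hβ hh
  have hG : ∀ a b : 𝕋, 0 ≤ isingTorusTwoPoint d L β 0 a b := fun a b => by
    rw [← thetaCorr_zeroField_pair_eq β h]
    exact thetaCorr_nonneg (zeroField_nonneg (ghostCoupling_nonneg hβ (mul_nonneg hβ hh)))
      (subset_univ _)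
  have := hG u k; have := hG u l; have := hG v k; have := hG v l
  have hq : 0 ≤ torusMag d L β h / (β * h) + 1 := add_nonneg (div_nonneg hM (mul_nonneg hβ hh)) zero_le_one
  positivity

/-- `Ξ ≥ 0`. [folklore] -/
theorem afXi_nonneg {β h : ℝ} (hβ : 0 ≤ β) (hh : 0 ≤ h) (e e' : Sym2 𝕋) : 0 ≤ afXi d L β h e e' :=
  sum_nonneg fun u _ => sum_nonneg fun v _ => sum_nonneg fun k _ => sum_nonneg fun l _ => by
    split_ifs
    · exact afXi_summand_nonneg hβ hh u v k l
    · exact le_rfl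

set_option maxHeartbeats 1600000 in
open Classical in
/-- **The dilution bound on the depletion functional** (Aizenman–Fernández 1986, (5.37)–(5.46),
with the second-order expansion along the scaling of the couplings of the bonds of the cluster
by `1 - p` in place of the random dilution, Prop. 5.2 for the diluted systems, translation
invariance (5.12)/(5.20) and `𝟙[{u,v} ∈ C(0)] ≥ 𝟙[0 ↔ u]`): for `β, h > 0`, `0 ≤ p ≤ 1` and a
current configuration with `0 ↮ g`,
`D(m) ≥ p β |C_m(0)| · ∂M/∂β - (p²/2) β² ∑_{e ≠ e' ∈ C_m(0)} Ξ(e,e')`. [cite: AizenmanFernandezJSP1986, §5.2, eqs. (5.37)–(5.47), pp. 437–439] -/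
theorem depletionSum_ge {β h : ℝ} (hβ : 0 < β) (hh : 0 < h) {p : ℝ} (hp0 : 0 ≤ p) (hp1 : p ≤ 1) {m : Eg → ℕ}
    (hm : ¬Conn[m, some 0, none]) :
    p * β * ((univ.filter fun u : 𝕋 => Conn[m, some 0, some u]).card : ℝ) * torusDbeta d L β h -
        p ^ 2 / 2 * β ^ 2 * ∑ e ∈ clusterBonds d L m, ∑ e' ∈ (clusterBonds d L m).erase e, afXi d L β h e e' ≤
      depletionSum d L β h m := by
  set θ : Sym2 (Option 𝕋) → ℝ := ghostCoupling β (β * h) with hθdef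
  have hθ : ∀ e, 0 ≤ θ e := fun e => ghostCoupling_nonneg hβ.le (mul_nonneg hβ.le hh.le) e
  set S : Finset (Option 𝕋) := 𝒮[m, some 0] with hSdef
  have hn : (none : Option 𝕋) ∈ S := none_mem_clusterCompl_iff.2 hm
  set D := clusterBonds d L m with hDdef
  have hD : D ⊆ edgesIn GT univ := clusterBonds_subset m
  set DL : Finset (Sym2 (Option 𝕋)) := D.map liftEdge with hDL
  set M : ℝ := torusMag d L β h with hMdef
  have hMv : ∀ a : 𝕋, thetaCorr GT univ θ {a} = M := fun a => by
    rw [hMdef, torusMag_eq_thetaCorr, hθdef]; exact thetaCorr_singleton_eq_zero_site β h a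
  -- Step 1: `D(m)` as a difference of one-point functions
  have hstep1 : depletionSum d L β h m = ∑ y : 𝕋, (thetaCorr GT univ θ {y} -
      thetaCorr GT univ (cplOff θ (Eg \ edgesIn Gg S)) {y}) := by
    unfold depletionSum
    refine sum_congr rfl fun y _ => ?_
    rw [← hSdef, depMag_eq_thetaCorr_cplOff hβ.le hh.le hn, hθdef, thetaCorr_ghostCoupling]
  -- Step 2: Griffiths, `θ 𝟙_{ℰ_S} ≤ θ` scaled by `1-p` on the cluster bonds
  have hle2 : ∀ e, cplOff θ (Eg \ edgesIn Gg S) e ≤ cplAt θ DL (1 - p) e := by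
    intro e
    by_cases heD : e ∈ DL
    · have hoff : cplOff θ (Eg \ edgesIn Gg S) e = 0 := by
        refine cplOff_of_mem (mem_sdiff.2 ⟨?_, fun heS => ?_⟩)
        · obtain ⟨e₀, he₀, rfl⟩ := mem_map.1 heD
          exact map_liftEdge_subset_edgesIn (G := GT) (Λ := univ) subset_rfl (mem_map_of_mem _ (hD he₀))
        · obtain ⟨e₀, he₀, rfl⟩ := mem_map.1 heD
          obtain ⟨-, u, hue, hcu⟩ := mem_filter.1 he₀
          have hsu : (some u : Option 𝕋) ∈ liftEdge e₀ := by
            induction e₀ using Sym2.ind with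
            | _ x y =>
              rw [liftEdge_mk]
              rcases Sym2.mem_iff.1 hue with rfl | rfl
              · exact Sym2.mem_mk_left _ _
              · exact Sym2.mem_mk_right _ _
          have hsuS : (some u : Option 𝕋) ∈ S := (mem_edgesIn_iff.1 heS).2 _ hsu
          exact (mem_clusterCompl.1 hsuS).2 hcu
      rw [hoff]
      exact cplAt_nonneg_all hθ DL (by linarith) e
    · have : cplAt θ DL (1 - p) e = θ e := by unfold cplAt; rw [if_neg heD]
      rw [this]
      exact cplOff_le hθ _ e
  have hstep2 : ∑ y : 𝕋, (thetaCorr GT univ θ {y} - thetaCorr GT univ (cplAt θ DL (1 - p)) {y}) ≤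
      depletionSum d L β h m := by
    rw [hstep1]
    refine sum_le_sum fun y _ => sub_le_sub_left ?_ _
    exact thetaCorr_mono (cplOff_nonneg hθ _) hle2 (subset_univ _)
  refine le_trans ?_ hstep2
  -- Step 3: the second-order expansion
  have hΞ : ∀ t ∈ Set.Icc (1 - p) 1, ∀ e ∈ D, ∀ e' ∈ D, e ≠ e' →
      ∑ y ∈ (univ : Finset 𝕋), thetaK3 GT univ (cplAt θ DL t) (spinAt y) (fun σ => bondSpin σ e) (fun σ => bondSpin σ e') ≤
        afXi d L β h e e' := by
    intro t ht e he e' he' hne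
    have ht0 : 0 ≤ t := by linarith [ht.1]
    have hθt0 : ∀ f, 0 ≤ cplAt θ DL t f := cplAt_nonneg_all hθ DL ht0
    have hθtle : ∀ f, cplAt θ DL t f ≤ θ f := cplAt_le_all hθ DL ht.2
    have hfield : ∀ z ∈ (univ : Finset 𝕋), cplAt θ DL t (ghostEdge z) = β * h := by
      intro z _
      have hz : ghostEdge z ∉ DL := fun hmem => by
        obtain ⟨e₀, -, he₀⟩ := mem_map.1 hmem
        exact liftEdge_ne_ghostEdge e₀ z he₀
      unfold cplAt; rw [if_neg hz, hθdef, ghostCoupling_ghostEdge]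
    have hMb : ∀ a ∈ (univ : Finset 𝕋), thetaCorr GT univ θ {a} ≤ M := fun a _ => (hMv a).le
    have heE := hD he
    have he'E := hD he'
    induction e using Sym2.ind with
    | _ u v =>
      induction e' using Sym2.ind with
      | _ k l =>
        have h1 := sum_thetaK3_le (G := GT) (Λ := univ) hθt0 hθtle (mul_pos hβ hh) hfield hMb heE he'E hne
        simp only [bondSpin_mk]
        refine h1.trans ?_
        rw [thetaCorr_zeroField_pair_eq, thetaCorr_zeroField_pair_eq, thetaCorr_zeroField_pair_eq, thetaCorr_zeroField_pair_eq]
        -- the term `(u,v,k,l)` of `Ξ`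
        have hv : v ∈ univ.filter ((torusGraph d L).Adj u) :=
          mem_filter.2 ⟨mem_univ _, (SimpleGraph.mem_edgeSet GT).1 (mem_edgesIn_iff.1 heE).1⟩
        have hl : l ∈ univ.filter ((torusGraph d L).Adj k) :=
          mem_filter.2 ⟨mem_univ _, (SimpleGraph.mem_edgeSet GT).1 (mem_edgesIn_iff.1 he'E).1⟩
        unfold afXi
        refine le_trans ?_ (single_le_sum (f := fun u' => ∑ v' ∈ univ.filter ((torusGraph d L).Adj u'), ∑ k' : 𝕋,
          ∑ l' ∈ univ.filter ((torusGraph d L).Adj k'), if s(u', v') = s(u, v) ∧ s(k', l') = s(k, l) then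
            12 * torusMag d L β h * (torusMag d L β h / (β * h) + 1) *
              (isingTorusTwoPoint d L β 0 u' k' + isingTorusTwoPoint d L β 0 u' l' +
                isingTorusTwoPoint d L β 0 v' k' + isingTorusTwoPoint d L β 0 v' l') else 0)
          (fun u' _ => sum_nonneg fun v' _ => sum_nonneg fun k' _ => sum_nonneg fun l' _ => by
            split_ifs
            · exact afXi_summand_nonneg hβ.le hh.le u' v' k' l'
            · exact le_rfl) (mem_univ u))
        refine le_trans ?_ (single_le_sum (f := fun v' => ∑ k' : 𝕋,
          ∑ l' ∈ univ.filter ((torusGraph d L).Adj k'), if s(u, v') = s(u, v) ∧ s(k', l') = s(k, l) then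
            12 * torusMag d L β h * (torusMag d L β h / (β * h) + 1) *
              (isingTorusTwoPoint d L β 0 u k' + isingTorusTwoPoint d L β 0 u l' +
                isingTorusTwoPoint d L β 0 v' k' + isingTorusTwoPoint d L β 0 v' l') else 0)
          (fun v' _ => sum_nonneg fun k' _ => sum_nonneg fun l' _ => by
            split_ifs
            · exact afXi_summand_nonneg hβ.le hh.le u v' k' l'
            · exact le_rfl) hv)
        refine le_trans ?_ (single_le_sum (f := fun k' => ∑ l' ∈ univ.filter ((torusGraph d L).Adj k'),
          if s(u, v) = s(u, v) ∧ s(k', l') = s(k, l) then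
            12 * torusMag d L β h * (torusMag d L β h / (β * h) + 1) *
              (isingTorusTwoPoint d L β 0 u k' + isingTorusTwoPoint d L β 0 u l' +
                isingTorusTwoPoint d L β 0 v k' + isingTorusTwoPoint d L β 0 v l') else 0)
          (fun k' _ => sum_nonneg fun l' _ => by
            split_ifs
            · exact afXi_summand_nonneg hβ.le hh.le u v k' l'
            · exact le_rfl) (mem_univ k))
        refine le_trans ?_ (single_le_sum (f := fun l' =>
          if s(u, v) = s(u, v) ∧ s(k, l') = s(k, l) then
            12 * torusMag d L β h * (torusMag d L β h / (β * h) + 1) *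
              (isingTorusTwoPoint d L β 0 u k + isingTorusTwoPoint d L β 0 u l' +
                isingTorusTwoPoint d L β 0 v k + isingTorusTwoPoint d L β 0 v l') else 0)
          (fun l' _ => by
            split_ifs
            · exact afXi_summand_nonneg hβ.le hh.le u v k l'
            · exact le_rfl) hl)
        rw [if_pos ⟨rfl, rfl⟩]
  have htaylor := theta_scaling_taylor (G := GT) (Λ := univ) hθ hD (subset_refl (univ : Finset 𝕋)) (afXi d L β h) hp0 hp1 hΞ
  refine le_trans ?_ htaylor
  -- Step 4: the first-order term
  simp only [hθdef, ghostCoupling_liftEdge]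
  rw [← hθdef]
  -- `g(e) = ∑_y ⟨σ_y; σ_uσ_v⟩`
  set gg : 𝕋 → 𝕋 → ℝ := fun u v => ∑ y : 𝕋, (thetaCorr GT univ θ ({y} ∆ ({u} ∆ {v})) -
    thetaCorr GT univ θ {y} * thetaCorr GT univ θ ({u} ∆ {v})) with hgg
  have hgg0 : ∀ u v : 𝕋, 0 ≤ gg u v := fun u v => sum_nonneg fun y _ =>
    sub_nonneg.2 (thetaCorr_mul_le_symmDiff hθ (subset_univ _) (subset_univ _))
  have hgE : ∀ {u v : 𝕋}, s(u, v) ∈ edgesIn GT univ →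
      ∑ y : 𝕋, (thetaExpect GT univ θ (fun σ => spinAt y σ * bondSpin σ s(u, v)) -
        thetaCorr GT univ θ {y} * thetaExpect GT univ θ (fun σ => bondSpin σ s(u, v))) = gg u v := by
    intro u v huv
    refine sum_congr rfl fun y _ => ?_
    have e1 : (fun σ : SpinConfig 𝕋 => spinAt y σ * bondSpin σ s(u, v)) = spinProduct ({y} ∆ ({u} ∆ {v})) := by
      funext σ
      rw [bondSpin_mk, ← spinProduct_singleton y, ← spinProduct_singleton u, ← spinProduct_singleton v,
        spinProduct_mul_spinProduct, spinProduct_mul_spinProduct]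
    have e2 : (fun σ : SpinConfig 𝕋 => bondSpin σ s(u, v)) = spinProduct ({u} ∆ {v}) := by
      funext σ; rw [bondSpin_mk, ← spinProduct_singleton u, ← spinProduct_singleton v, spinProduct_mul_spinProduct]
    rw [e1, e2]; rfl
  -- the counting inequality
  have hcount : ((univ.filter fun u : 𝕋 => Conn[m, some 0, some u]).card : ℝ) * torusDbeta d L β h ≤
      ∑ e ∈ D, ∑ y : 𝕋, (thetaExpect GT univ θ (fun σ => spinAt y σ * bondSpin σ e) -
        thetaCorr GT univ θ {y} * thetaExpect GT univ θ (fun σ => bondSpin σ e)) := by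
    -- `∑_{e ∈ D} g e = ½ ∑_u ∑_{v ∼ u} 𝟙[{u,v} ∈ D] gg u v`
    set f : 𝕋 → 𝕋 → ℝ := fun u v => if s(u, v) ∈ D then gg u v else 0 with hf
    have hsymm : ∑ u : 𝕋, ∑ v ∈ univ.filter ((torusGraph d L).Adj u), f u v =
        2 * ∑ e ∈ D, ∑ y : 𝕋, (thetaExpect GT univ θ (fun σ => spinAt y σ * bondSpin σ e) -
          thetaCorr GT univ θ {y} * thetaExpect GT univ θ (fun σ => bondSpin σ e)) := by
      rw [sum_adj_eq_sum_edgesIn (G := GT) (Λ := univ) f, mul_sum]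
      rw [← sum_filter_add_sum_filter_not (edgesIn GT univ) (· ∈ D)]
      have hzero : ∑ e ∈ (edgesIn GT univ).filter (fun e => e ∉ D),
          Sym2.lift ⟨fun x y => f x y + f y x, fun _ _ => add_comm _ _⟩ e = 0 := by
        refine sum_eq_zero fun e he => ?_
        obtain ⟨-, heD⟩ := mem_filter.1 he
        induction e using Sym2.ind with
        | _ x y =>
          simp only [Sym2.lift_mk, hf]
          rw [if_neg heD, if_neg (by rwa [Sym2.eq_swap]), add_zero]
      have hfilt : (edgesIn GT univ).filter (· ∈ D) = D := by
        ext e; simp only [mem_filter]; exact ⟨fun h => h.2, fun h => ⟨hD h, h⟩⟩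
      rw [hzero, add_zero, hfilt]
      refine sum_congr rfl fun e he => ?_
      induction e using Sym2.ind with
      | _ x y =>
        simp only [Sym2.lift_mk, hf]
        rw [if_pos he, if_pos (by rwa [Sym2.eq_swap]), hgE (hD he)]
        have : gg y x = gg x y := by
          simp only [hgg]; exact sum_congr rfl fun z _ => by rw [symmDiff_comm ({y} : Finset 𝕋) {x}]
        rw [this]; ring
    -- `𝟙[u ∈ C] gg u v ≤ f u v` for `v ∼ u`
    have hlow : ∑ u : 𝕋, ∑ v ∈ univ.filter ((torusGraph d L).Adj u),
        (if Conn[m, some 0, some u] then gg u v else 0) ≤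
        ∑ u : 𝕋, ∑ v ∈ univ.filter ((torusGraph d L).Adj u), f u v := by
      refine sum_le_sum fun u _ => sum_le_sum fun v hv => ?_
      by_cases hcu : Conn[m, some 0, some u]
      · rw [if_pos hcu]
        have hadj := (mem_filter.1 hv).2
        have hmem : s(u, v) ∈ D := mem_filter.2 ⟨mem_edgesIn_iff.2 ⟨(SimpleGraph.mem_edgeSet GT).2 hadj,
          fun w _ => mem_univ w⟩, u, Sym2.mem_mk_left u v, hcu⟩
        simp only [hf]; rw [if_pos hmem]
      · rw [if_neg hcu]; simp only [hf]; split_ifs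
        · exact hgg0 u v
        · exact le_rfl
    -- `∑_{v ∼ u} gg u v = 2 ∂M/∂β`
    have hD2 : ∀ u : 𝕋, ∑ v ∈ univ.filter ((torusGraph d L).Adj u), gg u v = 2 * torusDbeta d L β h := fun u => by
      simp only [hgg, hθdef]; exact sum_adj_sum_trunc_eq_two_mul_torusDbeta β h u
    have hleft : ∑ u : 𝕋, ∑ v ∈ univ.filter ((torusGraph d L).Adj u), (if Conn[m, some 0, some u] then gg u v else 0) =
        2 * (((univ.filter fun u : 𝕋 => Conn[m, some 0, some u]).card : ℝ) * torusDbeta d L β h) := by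
      have : ∀ u : 𝕋, ∑ v ∈ univ.filter ((torusGraph d L).Adj u), (if Conn[m, some 0, some u] then gg u v else 0) =
          if Conn[m, some 0, some u] then 2 * torusDbeta d L β h else 0 := by
        intro u; split_ifs
        · exact hD2 u
        · exact sum_const_zero
      simp_rw [this]
      rw [← sum_filter, sum_const, nsmul_eq_mul]
      ring
    linarith [hlow, hsymm, hleft]
  have hpβ : 0 ≤ p * β := mul_nonneg hp0 hβ.le
  have hfirst := mul_le_mul_of_nonneg_left hcount hpβ
  -- Step 5: the second-order term has the factor `β²`
  have hsecond : p ^ 2 / 2 * ∑ e ∈ D, ∑ e' ∈ D.erase e, β * β * afXi d L β h e e' =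
      p ^ 2 / 2 * β ^ 2 * ∑ e ∈ D, ∑ e' ∈ D.erase e, afXi d L β h e e' := by
    rw [mul_assoc (p ^ 2 / 2)]
    congr 1
    rw [mul_sum]; refine sum_congr rfl fun e _ => ?_
    rw [mul_sum]; exact sum_congr rfl fun e' _ => by ring
  rw [mul_sum] at hfirst
  have hfirst' : p * β * ((univ.filter fun u : 𝕋 => Conn[m, some 0, some u]).card : ℝ) * torusDbeta d L β h ≤
      p * ∑ e ∈ D, β * ∑ y : 𝕋, (thetaExpect GT univ θ (fun σ => spinAt y σ * bondSpin σ e) -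
        thetaCorr GT univ θ {y} * thetaExpect GT univ θ (fun σ => bondSpin σ e)) := by
    rw [mul_sum]
    calc p * β * ((univ.filter fun u : 𝕋 => Conn[m, some 0, some u]).card : ℝ) * torusDbeta d L β h
        = p * β * (((univ.filter fun u : 𝕋 => Conn[m, some 0, some u]).card : ℝ) * torusDbeta d L β h) := by ring
      _ ≤ ∑ e ∈ D, p * β * ∑ y : 𝕋, (thetaExpect GT univ θ (fun σ => spinAt y σ * bondSpin σ e) -
          thetaCorr GT univ θ {y} * thetaExpect GT univ θ (fun σ => bondSpin σ e)) := hfirst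
      _ = _ := sum_congr rfl fun e _ => by ring
  linarith [hfirst', hsecond.symm.le, hsecond.le]

/-! ### From bonds of the cluster to ordered pairs of vertices -/

variable (d L) in
/-- **The vertex-pair weight** `W(u,k) = ∑_{v ∼ u} ∑_{l ∼ k} 12 M (M/(βh)+1) ∑_{cross} ⟨σσ⟩_{h=0}`. [cite: AizenmanFernandezJSP1986, §5.2, eqs. (5.50)–(5.51), pp. 440–441] -/
def afW (β h : ℝ) (u k : 𝕋) : ℝ :=
  ∑ v ∈ univ.filter ((torusGraph d L).Adj u), ∑ l ∈ univ.filter ((torusGraph d L).Adj k),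
    12 * torusMag d L β h * (torusMag d L β h / (β * h) + 1) *
      (isingTorusTwoPoint d L β 0 u k + isingTorusTwoPoint d L β 0 u l +
        isingTorusTwoPoint d L β 0 v k + isingTorusTwoPoint d L β 0 v l)

/-- `W ≥ 0`. [folklore] -/
theorem afW_nonneg {β h : ℝ} (hβ : 0 ≤ β) (hh : 0 ≤ h) (u k : 𝕋) : 0 ≤ afW d L β h u k :=
  sum_nonneg fun v _ => sum_nonneg fun l _ => afXi_summand_nonneg hβ hh u v k l

open Classical in
/-- **`∑_{e ≠ e' ∈ C(0)} Ξ(e,e') ≤ 4 ∑_{u,k} W(u,k) 𝟙[0 ↔ u] 𝟙[0 ↔ k]`**: expand `Ξ` over ordered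
pairs, use `𝟙[{u,v} ∈ C(0)] ≤ 𝟙[0 ↔ u] + 𝟙[0 ↔ v]` ((iii) after (5.36)) and the symmetry of the
cross-link factor under `u ⇔ v`, `k ⇔ l`. [cite: AizenmanFernandezJSP1986, §5.2, (iii) after (5.36), p. 436, and (5.49)–(5.50)] -/
theorem sum_clusterBonds_afXi_le {β h : ℝ} (hβ : 0 ≤ β) (hh : 0 ≤ h) (m : Eg → ℕ) :
    ∑ e ∈ clusterBonds d L m, ∑ e' ∈ (clusterBonds d L m).erase e, afXi d L β h e e' ≤
      4 * ∑ u : 𝕋, ∑ k : 𝕋, afW d L β h u k *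
        (if Conn[m, some 0, some u] ∧ Conn[m, some 0, some k] then 1 else 0) := by
  set D := clusterBonds d L m with hDdef
  set F : 𝕋 → 𝕋 → 𝕋 → 𝕋 → ℝ := fun u v k l =>
    12 * torusMag d L β h * (torusMag d L β h / (β * h) + 1) *
      (isingTorusTwoPoint d L β 0 u k + isingTorusTwoPoint d L β 0 u l +
        isingTorusTwoPoint d L β 0 v k + isingTorusTwoPoint d L β 0 v l) with hF
  have hF0 : ∀ u v k l, 0 ≤ F u v k l := fun u v k l => afXi_summand_nonneg hβ hh u v k l
  have hFuv : ∀ u v k l, F v u k l = F u v k l := fun u v k l => by simp only [hF]; ring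
  have hFkl : ∀ u v k l, F u v l k = F u v k l := fun u v k l => by simp only [hF]; ring
  set c : 𝕋 → ℝ := fun u => if Conn[m, some 0, some u] then 1 else 0 with hc
  have hc0 : ∀ u, 0 ≤ c u := fun u => by simp only [hc]; split_ifs <;> norm_num
  -- Step 1: drop `e' ≠ e` and expand over ordered pairs
  have hstep1 : ∑ e ∈ D, ∑ e' ∈ D.erase e, afXi d L β h e e' ≤
      ∑ u : 𝕋, ∑ v ∈ univ.filter ((torusGraph d L).Adj u), ∑ k : 𝕋, ∑ l ∈ univ.filter ((torusGraph d L).Adj k),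
        (if s(u, v) ∈ D then 1 else 0) * (if s(k, l) ∈ D then 1 else 0) * F u v k l := by
    calc ∑ e ∈ D, ∑ e' ∈ D.erase e, afXi d L β h e e'
        ≤ ∑ e ∈ D, ∑ e' ∈ D, afXi d L β h e e' :=
          sum_le_sum fun e _ => sum_le_sum_of_subset_of_nonneg (erase_subset _ _) fun e' _ _ => afXi_nonneg hβ hh e e'
      _ = ∑ u : 𝕋, ∑ v ∈ univ.filter ((torusGraph d L).Adj u), ∑ k : 𝕋, ∑ l ∈ univ.filter ((torusGraph d L).Adj k),
            ∑ e ∈ D, ∑ e' ∈ D, (if s(u, v) = e ∧ s(k, l) = e' then F u v k l else 0) := by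
          unfold afXi
          -- move `e, e'` inside, one binder at a time
          set R : Sym2 𝕋 → Sym2 𝕋 → 𝕋 → 𝕋 → 𝕋 → 𝕋 → ℝ := fun e e' u v k l =>
            if s(u, v) = e ∧ s(k, l) = e' then F u v k l else 0 with hR
          change ∑ e ∈ D, ∑ e' ∈ D, ∑ u : 𝕋, ∑ v ∈ univ.filter ((torusGraph d L).Adj u), ∑ k : 𝕋,
              ∑ l ∈ univ.filter ((torusGraph d L).Adj k), R e e' u v k l =
            ∑ u : 𝕋, ∑ v ∈ univ.filter ((torusGraph d L).Adj u), ∑ k : 𝕋, ∑ l ∈ univ.filter ((torusGraph d L).Adj k),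
              ∑ e ∈ D, ∑ e' ∈ D, R e e' u v k l
          have s1 : ∀ (φ : Sym2 𝕋 → Sym2 𝕋 → 𝕋 → ℝ) (T : Finset 𝕋),
              ∑ e ∈ D, ∑ e' ∈ D, ∑ u ∈ T, φ e e' u = ∑ u ∈ T, ∑ e ∈ D, ∑ e' ∈ D, φ e e' u := by
            intro φ T
            calc ∑ e ∈ D, ∑ e' ∈ D, ∑ u ∈ T, φ e e' u = ∑ e ∈ D, ∑ u ∈ T, ∑ e' ∈ D, φ e e' u :=
                  sum_congr rfl fun e _ => sum_comm
              _ = ∑ u ∈ T, ∑ e ∈ D, ∑ e' ∈ D, φ e e' u := sum_comm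
          rw [s1]
          refine sum_congr rfl fun u _ => ?_
          rw [s1]
          refine sum_congr rfl fun v _ => ?_
          rw [s1]
          refine sum_congr rfl fun k _ => ?_
          rw [s1]
      _ = _ := by
          refine sum_congr rfl fun u _ => sum_congr rfl fun v _ => sum_congr rfl fun k _ => sum_congr rfl fun l _ => ?_
          have : ∀ e ∈ D, ∑ e' ∈ D, (if s(u, v) = e ∧ s(k, l) = e' then F u v k l else 0) =
              if s(u, v) = e then (if s(k, l) ∈ D then F u v k l else 0) else 0 := by
            intro e _
            by_cases he : s(u, v) = e
            · rw [if_pos he]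
              simp only [he, true_and]
              rw [Finset.sum_ite_eq]
            · rw [if_neg he]
              exact sum_eq_zero fun e' _ => if_neg fun h' => he h'.1
          rw [sum_congr rfl this, Finset.sum_ite_eq]
          by_cases h1 : s(u, v) ∈ D <;> by_cases h2 : s(k, l) ∈ D <;> simp [h1, h2]
  -- Step 2: `𝟙[{u,v} ∈ D] ≤ c u + c v`
  have hind : ∀ u v : 𝕋, (if s(u, v) ∈ D then (1 : ℝ) else 0) ≤ c u + c v := by
    intro u v
    by_cases h : s(u, v) ∈ D
    · rw [if_pos h]
      obtain ⟨-, w, hw, hcw⟩ := mem_filter.1 h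
      rcases Sym2.mem_iff.1 hw with rfl | rfl
      · simp only [hc]; rw [if_pos hcw]; linarith [hc0 v]
      · simp only [hc]; rw [if_pos hcw]; linarith [hc0 u]
    · rw [if_neg h]; exact add_nonneg (hc0 u) (hc0 v)
  have hstep2 : ∑ u : 𝕋, ∑ v ∈ univ.filter ((torusGraph d L).Adj u), ∑ k : 𝕋, ∑ l ∈ univ.filter ((torusGraph d L).Adj k),
        (if s(u, v) ∈ D then 1 else 0) * (if s(k, l) ∈ D then 1 else 0) * F u v k l ≤
      ∑ u : 𝕋, ∑ v ∈ univ.filter ((torusGraph d L).Adj u), ∑ k : 𝕋, ∑ l ∈ univ.filter ((torusGraph d L).Adj k),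
        (c u + c v) * (c k + c l) * F u v k l := by
    refine sum_le_sum fun u _ => sum_le_sum fun v _ => sum_le_sum fun k _ => sum_le_sum fun l _ => ?_
    refine mul_le_mul_of_nonneg_right (mul_le_mul (hind u v) (hind k l) (by split_ifs <;> norm_num)
      (add_nonneg (hc0 u) (hc0 v))) (hF0 u v k l)
  -- Step 3: symmetry, the four terms are equal
  have hsym_v : ∑ u : 𝕋, ∑ v ∈ univ.filter ((torusGraph d L).Adj u), ∑ k : 𝕋, ∑ l ∈ univ.filter ((torusGraph d L).Adj k),
        c v * (c k + c l) * F u v k l =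
      ∑ u : 𝕋, ∑ v ∈ univ.filter ((torusGraph d L).Adj u), ∑ k : 𝕋, ∑ l ∈ univ.filter ((torusGraph d L).Adj k),
        c u * (c k + c l) * F u v k l := by
    rw [sum_adj_comm (fun u v => ∑ k : 𝕋, ∑ l ∈ univ.filter ((torusGraph d L).Adj k), c v * (c k + c l) * F u v k l)]
    refine sum_congr rfl fun u _ => sum_congr rfl fun v _ => sum_congr rfl fun k _ => sum_congr rfl fun l _ => ?_
    rw [hFuv]
  have hsym_l : ∀ u v : 𝕋, ∑ k : 𝕋, ∑ l ∈ univ.filter ((torusGraph d L).Adj k), c l * F u v k l =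
      ∑ k : 𝕋, ∑ l ∈ univ.filter ((torusGraph d L).Adj k), c k * F u v k l := by
    intro u v
    rw [sum_adj_comm (fun k l => c l * F u v k l)]
    refine sum_congr rfl fun k _ => sum_congr rfl fun l _ => ?_
    rw [hFkl]
  have hstep3 : ∑ u : 𝕋, ∑ v ∈ univ.filter ((torusGraph d L).Adj u), ∑ k : 𝕋, ∑ l ∈ univ.filter ((torusGraph d L).Adj k),
        (c u + c v) * (c k + c l) * F u v k l =
      4 * ∑ u : 𝕋, ∑ v ∈ univ.filter ((torusGraph d L).Adj u), ∑ k : 𝕋, ∑ l ∈ univ.filter ((torusGraph d L).Adj k),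
        c u * c k * F u v k l := by
    have h1 : ∑ u : 𝕋, ∑ v ∈ univ.filter ((torusGraph d L).Adj u), ∑ k : 𝕋, ∑ l ∈ univ.filter ((torusGraph d L).Adj k),
        (c u + c v) * (c k + c l) * F u v k l =
        (∑ u : 𝕋, ∑ v ∈ univ.filter ((torusGraph d L).Adj u), ∑ k : 𝕋, ∑ l ∈ univ.filter ((torusGraph d L).Adj k),
          c u * (c k + c l) * F u v k l) +
        ∑ u : 𝕋, ∑ v ∈ univ.filter ((torusGraph d L).Adj u), ∑ k : 𝕋, ∑ l ∈ univ.filter ((torusGraph d L).Adj k),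
          c v * (c k + c l) * F u v k l := by
      simp only [← sum_add_distrib]
      refine sum_congr rfl fun u _ => sum_congr rfl fun v _ => sum_congr rfl fun k _ => sum_congr rfl fun l _ => by ring
    have h2 : ∀ u v : 𝕋, ∑ k : 𝕋, ∑ l ∈ univ.filter ((torusGraph d L).Adj k), c u * (c k + c l) * F u v k l =
        2 * ∑ k : 𝕋, ∑ l ∈ univ.filter ((torusGraph d L).Adj k), c u * c k * F u v k l := by
      intro u v
      have hA : ∑ k : 𝕋, ∑ l ∈ univ.filter ((torusGraph d L).Adj k), c u * (c k + c l) * F u v k l =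
          (∑ k : 𝕋, ∑ l ∈ univ.filter ((torusGraph d L).Adj k), c u * c k * F u v k l) +
          ∑ k : 𝕋, ∑ l ∈ univ.filter ((torusGraph d L).Adj k), c u * c l * F u v k l := by
        rw [← sum_add_distrib]
        refine sum_congr rfl fun k _ => ?_
        rw [← sum_add_distrib]
        exact sum_congr rfl fun l _ => by ring
      have hB : ∑ k : 𝕋, ∑ l ∈ univ.filter ((torusGraph d L).Adj k), c u * c l * F u v k l =
          c u * ∑ k : 𝕋, ∑ l ∈ univ.filter ((torusGraph d L).Adj k), c l * F u v k l := by
        rw [mul_sum]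
        refine sum_congr rfl fun k _ => ?_
        rw [mul_sum]
        exact sum_congr rfl fun l _ => by ring
      have hC : ∑ k : 𝕋, ∑ l ∈ univ.filter ((torusGraph d L).Adj k), c u * c k * F u v k l =
          c u * ∑ k : 𝕋, ∑ l ∈ univ.filter ((torusGraph d L).Adj k), c k * F u v k l := by
        rw [mul_sum]
        refine sum_congr rfl fun k _ => ?_
        rw [mul_sum]
        exact sum_congr rfl fun l _ => by ring
      rw [hA, hB, hsym_l u v, ← hC]
      ring
    rw [h1, hsym_v, ← two_mul, sum_congr rfl fun u _ => sum_congr rfl fun v _ => h2 u v]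
    simp only [← mul_sum]
    ring
  -- Step 4: identify `W`
  have hstep4 : ∑ u : 𝕋, ∑ v ∈ univ.filter ((torusGraph d L).Adj u), ∑ k : 𝕋, ∑ l ∈ univ.filter ((torusGraph d L).Adj k),
        c u * c k * F u v k l =
      ∑ u : 𝕋, ∑ k : 𝕋, afW d L β h u k * (if Conn[m, some 0, some u] ∧ Conn[m, some 0, some k] then 1 else 0) := by
    refine sum_congr rfl fun u _ => ?_
    rw [sum_comm]
    refine sum_congr rfl fun k _ => ?_
    unfold afW
    rw [sum_mul]
    refine sum_congr rfl fun v _ => ?_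
    rw [sum_mul]
    refine sum_congr rfl fun l _ => ?_
    have hck : c u * c k = if Conn[m, some 0, some u] ∧ Conn[m, some 0, some k] then 1 else 0 := by
      simp only [hc]
      by_cases h1 : Conn[m, some 0, some u] <;> by_cases h2 : Conn[m, some 0, some k] <;> simp [h1, h2]
    rw [← hck]; simp only [hF]; ring
  linarith [hstep1, hstep2, hstep3.le, hstep4.le, hstep3.ge, hstep4.ge]

/-! ### The differential inequality before optimisation in `p` -/

/-- Finiteness of a pair sum with a bounded functional. [folklore] -/
theorem currentPairSum_ne_top_of_le_const {θ : Sym2 (Option 𝕋) → ℝ} (hθ : ∀ e, 0 ≤ θ e) (X : Finset (Option 𝕋))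
    {F : (Eg → ℕ) → ℝ≥0∞} {c : ℝ≥0∞} (hc : c ≠ ∞) (hF : ∀ m, F m ≤ c) : PS[θ, X, F] ≠ ∞ := by
  have h1 : PS[θ, X, F] ≤ PS[θ, X, fun _ => c * 1] := currentPairSum_mono fun n₁ n₂ _ _ => by simpa using hF _
  rw [currentPairSum_mul_left] at h1
  exact ne_top_of_le_ne_top (ENNReal.mul_ne_top hc (currentPairSum_ne_top hθ _ _ fun _ => le_rfl)) h1

set_option maxHeartbeats 800000 in
open Classical in
/-- **The random-current differential inequality, before the choice of the dilution parameter**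
(Aizenman–Fernández 1986, (5.34)–(5.52) on the torus with the repaired bound on `R`): for
`β, h > 0` and every `0 ≤ p ≤ 1`,
`-ū₃ ≥ 2pβ (∂M/∂β) χ² - 4p²β² ∑_{u,k} W(u,k) ⟨σ_kσ_u⟩₀ [G♭(u,0) + G♭(0,k)] M/(βh)`. [cite: AizenmanFernandezJSP1986, §5.2, proof of Thm. 5.7, eqs. (5.34)–(5.52), pp. 435–441] -/
theorem neg_torusU3_ge {β h : ℝ} (hβ : 0 < β) (hh : 0 < h) {p : ℝ} (hp0 : 0 ≤ p) (hp1 : p ≤ 1) :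
    2 * (p * β * torusDbeta d L β h * torusSusc d L β h ^ 2) -
        4 * p ^ 2 * β ^ 2 * ∑ u : 𝕋, ∑ k : 𝕋, afW d L β h u k * (isingTorusTwoPoint d L β 0 k u *
          ((gAvoidZ GT univ (ghostCoupling β (β * h)) u 0).toReal / (ZT[ghostCoupling β (β * h)]).toReal *
              (torusMag d L β h / (β * h)) +
            (gAvoidZ GT univ (ghostCoupling β (β * h)) 0 k).toReal / (ZT[ghostCoupling β (β * h)]).toReal *
              (torusMag d L β h / (β * h)))) ≤
      -torusU3 d L β h := by
  set θ : Sym2 (Option 𝕋) → ℝ := ghostCoupling β (β * h) with hθdef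
  have hθ : ∀ e, 0 ≤ θ e := fun e => ghostCoupling_nonneg hβ.le (mul_nonneg hβ.le hh.le) e
  set Z : ℝ := (ZT[θ]).toReal with hZ
  have hZpos : 0 < Z := toReal_gcurrentZ_ghost_empty_pos subset_rfl hθ subset_rfl
  set M : ℝ := torusMag d L β h with hMdef
  have hMfree : ∀ a : 𝕋, isingCorr GT univ β h .free {a} = M := fun a => by
    rw [hMdef, torusMag_eq_thetaCorr, ← thetaCorr_ghostCoupling]; exact thetaCorr_singleton_eq_zero_site β h a
  have hD0 : 0 ≤ torusDbeta d L β h := torusDbeta_nonneg hβ.le hh.le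
  set cA : ℝ := p * β * torusDbeta d L β h with hcA
  have hcA0 : 0 ≤ cA := mul_nonneg (mul_nonneg hp0 hβ.le) hD0
  set cB : ℝ := 2 * p ^ 2 * β ^ 2 with hcB
  have hcB0 : 0 ≤ cB := by positivity
  -- the three functionals
  set FD : (Eg → ℕ) → ℝ≥0∞ := fun m => ind (¬Conn[m, some 0, none]) * ENNReal.ofReal (depletionSum d L β h m) with hFD
  set FA : (Eg → ℕ) → ℝ≥0∞ := fun m => ind (¬Conn[m, some 0, none]) *
    ENNReal.ofReal (cA * ((univ.filter fun u : 𝕋 => Conn[m, some 0, some u]).card : ℝ)) with hFA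
  set Bf : (Eg → ℕ) → ℝ := fun m => ∑ u : 𝕋, ∑ k : 𝕋, afW d L β h u k *
    (if Conn[m, some 0, some u] ∧ Conn[m, some 0, some k] then 1 else 0) with hBf
  have hBf0 : ∀ m, 0 ≤ Bf m := fun m => sum_nonneg fun u _ => sum_nonneg fun k _ =>
    mul_nonneg (afW_nonneg hβ.le hh.le u k) (by split_ifs <;> norm_num)
  set FB : (Eg → ℕ) → ℝ≥0∞ := fun m => ind (¬Conn[m, some 0, none]) * ENNReal.ofReal (cB * Bf m) with hFB
  -- pointwise: `FA ≤ FD + FB`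
  have hpt : ∀ m, FA m ≤ FD m + FB m := by
    intro m
    by_cases hm : Conn[m, some 0, none]
    · simp only [hFA, hFD, hFB]
      rw [ind_of_false (not_not_intro hm)]; simp
    · simp only [hFA, hFD, hFB]
      rw [ind_of_true hm, one_mul, one_mul, one_mul, ← ENNReal.ofReal_add (depletionSum_nonneg hβ.le hh.le m)
        (mul_nonneg hcB0 (hBf0 m))]
      refine ENNReal.ofReal_le_ofReal ?_
      have h1 := depletionSum_ge (d := d) (L := L) hβ hh hp0 hp1 hm
      have h2 := sum_clusterBonds_afXi_le (d := d) (L := L) hβ.le hh.le m (β := β) (h := h)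
      have h3 : p ^ 2 / 2 * β ^ 2 * ∑ e ∈ clusterBonds d L m, ∑ e' ∈ (clusterBonds d L m).erase e, afXi d L β h e e' ≤
          cB * Bf m := by
        calc p ^ 2 / 2 * β ^ 2 * ∑ e ∈ clusterBonds d L m, ∑ e' ∈ (clusterBonds d L m).erase e, afXi d L β h e e'
            ≤ p ^ 2 / 2 * β ^ 2 * (4 * Bf m) := mul_le_mul_of_nonneg_left h2 (by positivity)
          _ = cB * Bf m := by simp only [hcB]; ring
      have : cA * ((univ.filter fun u : 𝕋 => Conn[m, some 0, some u]).card : ℝ) =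
          p * β * ((univ.filter fun u : 𝕋 => Conn[m, some 0, some u]).card : ℝ) * torusDbeta d L β h := by
        simp only [hcA]; ring
      linarith
  -- finiteness
  have hcardle : ∀ m : Eg → ℕ, ((univ.filter fun u : 𝕋 => Conn[m, some 0, some u]).card : ℝ) ≤ Fintype.card 𝕋 :=
    fun m => by exact_mod_cast card_le_univ _
  have hFAfin : ∀ x : 𝕋, PS[θ, starSet ({(0 : 𝕋)} ∆ {x}), FA] ≠ ∞ := fun x =>
    currentPairSum_ne_top_of_le_const hθ _ (c := ENNReal.ofReal (cA * Fintype.card 𝕋)) ENNReal.ofReal_ne_top fun m =>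
      le_trans (mul_le_mul' (ind_le_one _) (ENNReal.ofReal_le_ofReal (mul_le_mul_of_nonneg_left (hcardle m) hcA0)))
        (by rw [one_mul])
  have hDle : ∀ m : Eg → ℕ, depletionSum d L β h m ≤ Fintype.card 𝕋 := fun m => by
    unfold depletionSum
    calc ∑ y : 𝕋, (isingCorr GT univ β h .free {y} - depMag GT β h (𝒮[m, some 0]) y)
        ≤ ∑ _y : 𝕋, (1 : ℝ) := sum_le_sum fun y _ => by
          linarith [isingCorr_le_one' (G := GT) univ β h .free {y}, depMag_nonneg (G := GT) hβ.le hh.le (𝒮[m, some 0]) y]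
      _ = Fintype.card 𝕋 := by simp
  have hFDfin : ∀ x : 𝕋, PS[θ, starSet ({(0 : 𝕋)} ∆ {x}), FD] ≠ ∞ := fun x =>
    currentPairSum_ne_top_of_le_const hθ _ (c := ENNReal.ofReal (Fintype.card 𝕋)) ENNReal.ofReal_ne_top fun m =>
      le_trans (mul_le_mul' (ind_le_one _) (ENNReal.ofReal_le_ofReal (hDle m))) (by rw [one_mul])
  have hBle : ∀ m : Eg → ℕ, Bf m ≤ ∑ u : 𝕋, ∑ k : 𝕋, afW d L β h u k := fun m =>
    sum_le_sum fun u _ => sum_le_sum fun k _ => by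
      have := afW_nonneg (d := d) (L := L) hβ.le hh.le u k (β := β) (h := h)
      split_ifs <;> nlinarith
  have hFBfin : ∀ x : 𝕋, PS[θ, starSet ({(0 : 𝕋)} ∆ {x}), FB] ≠ ∞ := fun x =>
    currentPairSum_ne_top_of_le_const hθ _ (c := ENNReal.ofReal (cB * ∑ u : 𝕋, ∑ k : 𝕋, afW d L β h u k))
      ENNReal.ofReal_ne_top fun m =>
      le_trans (mul_le_mul' (ind_le_one _) (ENNReal.ofReal_le_ofReal (mul_le_mul_of_nonneg_left (hBle m) hcB0)))
        (by rw [one_mul])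
  -- the summed inequality in `ℝ`
  have hsum : ∑ x : 𝕋, (PS[θ, starSet ({(0 : 𝕋)} ∆ {x}), FA]).toReal ≤
      ∑ x : 𝕋, (PS[θ, starSet ({(0 : 𝕋)} ∆ {x}), FD]).toReal + ∑ x : 𝕋, (PS[θ, starSet ({(0 : 𝕋)} ∆ {x}), FB]).toReal := by
    rw [← sum_add_distrib]
    refine sum_le_sum fun x _ => ?_
    rw [← ENNReal.toReal_add (hFDfin x) (hFBfin x), ← currentPairSum_add]
    exact ENNReal.toReal_mono (by rw [currentPairSum_add]; exact ENNReal.add_ne_top.2 ⟨hFDfin x, hFBfin x⟩)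
      (currentPairSum_mono fun n₁ n₂ _ _ => hpt _)
  -- the first-order term
  have hA : cA * (torusSusc d L β h ^ 2 * Z ^ 2) ≤ ∑ x : 𝕋, (PS[θ, starSet ({(0 : 𝕋)} ∆ {x}), FA]).toReal := by
    have hE3 := sum_currentPairSum_clusterCard_eq (d := d) (L := L) hβ.le hh.le hcA0 (β := β) (h := h)
    rw [← hθdef] at hE3
    change ∑ x : 𝕋, (PS[θ, starSet ({(0 : 𝕋)} ∆ {x}), FA]).toReal = _ at hE3
    rw [hE3]
    refine mul_le_mul_of_nonneg_left ?_ hcA0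
    have hF5 := afClusterSize_ge_susc_sq (d := d) (L := L) hβ.le hh.le (β := β) (h := h)
    have hχ : ∑ y : 𝕋, (isingCorr GT univ β h .free ({(0 : 𝕋)} ∆ {y}) -
        isingCorr GT univ β h .free {(0 : 𝕋)} * isingCorr GT univ β h .free {y}) = torusSusc d L β h := by
      rw [torusSusc_eq_sum_thetaCorr]
      simp only [← thetaCorr_ghostCoupling]
    rw [hχ] at hF5
    rw [← hθdef] at hF5
    have : ∑ x : 𝕋, ∑ u : 𝕋, (PS[θ, starSet ({(0 : 𝕋)} ∆ {x}),
        fun m => ind (¬Conn[m, some 0, none]) * ind (Conn[m, some 0, some u])]).toReal / Z ^ 2 =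
        (∑ x : 𝕋, ∑ u : 𝕋, (PS[θ, starSet ({(0 : 𝕋)} ∆ {x}),
          fun m => ind (¬Conn[m, some 0, none]) * ind (Conn[m, some 0, some u])]).toReal) / Z ^ 2 := by
      rw [sum_div]; exact sum_congr rfl fun x _ => by rw [sum_div]
    rw [this, le_div_iff₀ (pow_pos hZpos 2)] at hF5
    exact hF5
  -- the second-order term
  have hB : ∑ x : 𝕋, (PS[θ, starSet ({(0 : 𝕋)} ∆ {x}), FB]).toReal ≤
      cB * (Z ^ 2 * ∑ u : 𝕋, ∑ k : 𝕋, afW d L β h u k * (isingTorusTwoPoint d L β 0 k u *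
        ((gAvoidZ GT univ θ u 0).toReal / Z * (M / (β * h)) + (gAvoidZ GT univ θ 0 k).toReal / Z * (M / (β * h))))) := by
    have hE4 := sum_currentPairSum_weight_le (d := d) (L := L) hβ hh (W := afW d L β h) (afW_nonneg hβ.le hh.le)
    rw [← hθdef] at hE4
    have hlin : ∀ x : 𝕋, (PS[θ, starSet ({(0 : 𝕋)} ∆ {x}), FB]).toReal =
        cB * (PS[θ, starSet ({(0 : 𝕋)} ∆ {x}), fun m => ind (¬Conn[m, some 0, none]) * ENNReal.ofReal (Bf m)]).toReal := by
      intro x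
      have : FB = fun m => ENNReal.ofReal cB * (ind (¬Conn[m, some 0, none]) * ENNReal.ofReal (Bf m)) := by
        funext m; simp only [hFB]; rw [ENNReal.ofReal_mul hcB0]; ring
      rw [this, currentPairSum_mul_left, ENNReal.toReal_mul, ENNReal.toReal_ofReal hcB0]
    simp_rw [hlin]
    rw [← mul_sum]
    refine mul_le_mul_of_nonneg_left ?_ hcB0
    refine hE4.trans (le_of_eq ?_)
    congr 1
    refine sum_congr rfl fun u _ => sum_congr rfl fun k _ => ?_
    rw [hMfree k, hMfree u, isingTorusTwoPoint, isingTwoPoint_eq_isingCorr_symmDiff]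
  -- assemble
  rw [neg_torusU3_eq hβ.le hh.le, ← hθdef]
  change 2 * (p * β * torusDbeta d L β h * torusSusc d L β h ^ 2) -
      4 * p ^ 2 * β ^ 2 * ∑ u : 𝕋, ∑ k : 𝕋, afW d L β h u k * (isingTorusTwoPoint d L β 0 k u *
        ((gAvoidZ GT univ θ u 0).toReal / Z * (M / (β * h)) + (gAvoidZ GT univ θ 0 k).toReal / Z * (M / (β * h)))) ≤
    2 * (∑ x : 𝕋, (PS[θ, starSet ({(0 : 𝕋)} ∆ {x}), FD]).toReal) / Z ^ 2
  rw [le_div_iff₀ (pow_pos hZpos 2)]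
  have hZ2 : 0 < Z ^ 2 := pow_pos hZpos 2
  set SWR := ∑ u : 𝕋, ∑ k : 𝕋, afW d L β h u k * (isingTorusTwoPoint d L β 0 k u *
    ((gAvoidZ GT univ θ u 0).toReal / Z * (M / (β * h)) + (gAvoidZ GT univ θ 0 k).toReal / Z * (M / (β * h))))
  have key : cA * (torusSusc d L β h ^ 2 * Z ^ 2) - cB * (Z ^ 2 * SWR) ≤
      ∑ x : 𝕋, (PS[θ, starSet ({(0 : 𝕋)} ∆ {x}), FD]).toReal := by linarith
  have expand : (2 * (p * β * torusDbeta d L β h * torusSusc d L β h ^ 2) - 4 * p ^ 2 * β ^ 2 * SWR) * Z ^ 2 =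
      2 * (cA * (torusSusc d L β h ^ 2 * Z ^ 2) - cB * (Z ^ 2 * SWR)) := by
    simp only [hcA, hcB]; ring
  rw [expand]
  linarith

/-! ### The bubble bounds (AM–GM in place of the Schwarz inequality (5.51)) -/

/-- `∑_k ⟨σ_aσ_k⟩²_{h=0} = B_L` for every `a`. [cite: AizenmanFernandezJSP1986, §5.2, eq. (5.26), p. 433] -/
theorem sum_isingTorusTwoPoint_sq_eq_torusBubble' (β : ℝ) (a : 𝕋) :
    ∑ k : 𝕋, isingTorusTwoPoint d L β 0 a k ^ 2 = torusBubble d L β := by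
  rw [← sum_isingTorusTwoPoint_sq_eq_torusBubble β a]
  exact sum_congr rfl fun k _ => by rw [isingTorusTwoPoint_comm]

/-- AM–GM bubble bound, pattern `∑_k ∑_{l ∼ k} ⟨σ_aσ_k⟩₀ ⟨σ_kσ_w⟩₀ ≤ deg · B_L`. [cite: AizenmanFernandezJSP1986, §5.2, eq. (5.51), p. 441] -/
theorem sum_adj_twoPoint_mul_le_a (β : ℝ) (a w : 𝕋) :
    ∑ k : 𝕋, ∑ _l ∈ univ.filter ((torusGraph d L).Adj k), isingTorusTwoPoint d L β 0 a k * isingTorusTwoPoint d L β 0 k w ≤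
      ((univ.filter ((torusGraph d L).Adj (0 : 𝕋))).card : ℝ) * torusBubble d L β := by
  set deg : ℝ := ((univ.filter ((torusGraph d L).Adj (0 : 𝕋))).card : ℝ) with hdeg
  have hdeg0 : 0 ≤ deg := Nat.cast_nonneg _
  have h1 : ∀ k : 𝕋, ∑ _l ∈ univ.filter ((torusGraph d L).Adj k), isingTorusTwoPoint d L β 0 a k * isingTorusTwoPoint d L β 0 k w =
      deg * (isingTorusTwoPoint d L β 0 a k * isingTorusTwoPoint d L β 0 k w) := fun k => by
    rw [sum_const, card_filter_adj_eq k, nsmul_eq_mul]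
  simp_rw [h1]
  rw [← mul_sum]
  refine mul_le_mul_of_nonneg_left ?_ hdeg0
  calc ∑ k : 𝕋, isingTorusTwoPoint d L β 0 a k * isingTorusTwoPoint d L β 0 k w
      ≤ ∑ k : 𝕋, (isingTorusTwoPoint d L β 0 a k ^ 2 + isingTorusTwoPoint d L β 0 k w ^ 2) / 2 :=
        sum_le_sum fun k _ => by nlinarith [sq_nonneg (isingTorusTwoPoint d L β 0 a k - isingTorusTwoPoint d L β 0 k w)]
    _ = torusBubble d L β := by
        rw [← sum_div, sum_add_distrib, sum_isingTorusTwoPoint_sq_eq_torusBubble', sum_isingTorusTwoPoint_sq_eq_torusBubble]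
        ring

/-- AM–GM bubble bound, pattern `∑_k ∑_{l ∼ k} ⟨σ_aσ_l⟩₀ ⟨σ_kσ_w⟩₀ ≤ deg · B_L`. [cite: AizenmanFernandezJSP1986, §5.2, eq. (5.51), p. 441] -/
theorem sum_adj_twoPoint_mul_le_b (β : ℝ) (a w : 𝕋) :
    ∑ k : 𝕋, ∑ l ∈ univ.filter ((torusGraph d L).Adj k), isingTorusTwoPoint d L β 0 a l * isingTorusTwoPoint d L β 0 k w ≤
      ((univ.filter ((torusGraph d L).Adj (0 : 𝕋))).card : ℝ) * torusBubble d L β := by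
  set deg : ℝ := ((univ.filter ((torusGraph d L).Adj (0 : 𝕋))).card : ℝ) with hdeg
  calc ∑ k : 𝕋, ∑ l ∈ univ.filter ((torusGraph d L).Adj k), isingTorusTwoPoint d L β 0 a l * isingTorusTwoPoint d L β 0 k w
      ≤ ∑ k : 𝕋, ∑ l ∈ univ.filter ((torusGraph d L).Adj k),
          (isingTorusTwoPoint d L β 0 a l ^ 2 + isingTorusTwoPoint d L β 0 k w ^ 2) / 2 :=
        sum_le_sum fun k _ => sum_le_sum fun l _ => by
          nlinarith [sq_nonneg (isingTorusTwoPoint d L β 0 a l - isingTorusTwoPoint d L β 0 k w)]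
    _ = (1 / 2) * (∑ k : 𝕋, ∑ l ∈ univ.filter ((torusGraph d L).Adj k), isingTorusTwoPoint d L β 0 a l ^ 2) +
          (1 / 2) * ∑ k : 𝕋, ∑ _l ∈ univ.filter ((torusGraph d L).Adj k), isingTorusTwoPoint d L β 0 k w ^ 2 := by
        rw [mul_sum, mul_sum, ← sum_add_distrib]
        refine sum_congr rfl fun k _ => ?_
        rw [mul_sum, mul_sum, ← sum_add_distrib]
        exact sum_congr rfl fun l _ => by ring
    _ = (1 / 2) * (deg * torusBubble d L β) + (1 / 2) * (deg * torusBubble d L β) := by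
        congr 2
        · rw [sum_adj_comm (fun k l => isingTorusTwoPoint d L β 0 a l ^ 2)]
          have : ∀ k : 𝕋, ∑ _l ∈ univ.filter ((torusGraph d L).Adj k), isingTorusTwoPoint d L β 0 a k ^ 2 =
              deg * isingTorusTwoPoint d L β 0 a k ^ 2 := fun k => by rw [sum_const, card_filter_adj_eq k, nsmul_eq_mul]
          simp_rw [this]
          rw [← mul_sum, sum_isingTorusTwoPoint_sq_eq_torusBubble']
        · have : ∀ k : 𝕋, ∑ _l ∈ univ.filter ((torusGraph d L).Adj k), isingTorusTwoPoint d L β 0 k w ^ 2 =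
              deg * isingTorusTwoPoint d L β 0 k w ^ 2 := fun k => by rw [sum_const, card_filter_adj_eq k, nsmul_eq_mul]
          simp_rw [this]
          rw [← mul_sum, sum_isingTorusTwoPoint_sq_eq_torusBubble]
    _ = deg * torusBubble d L β := by ring

/-- **The cross-link sum against one more link is at most `4 deg B_L`** (for a fixed bond `(u,v)`):
`∑_k ∑_{l∼k} (⟨uk⟩+⟨ul⟩+⟨vk⟩+⟨vl⟩)₀ ⟨ku⟩₀ ≤ 4 deg B_L`. [cite: AizenmanFernandezJSP1986, §5.2, eq. (5.51), p. 441] -/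
theorem sum_cross_mul_link_le (β : ℝ) (u v : 𝕋) :
    ∑ k : 𝕋, ∑ l ∈ univ.filter ((torusGraph d L).Adj k),
        (isingTorusTwoPoint d L β 0 u k + isingTorusTwoPoint d L β 0 u l +
          isingTorusTwoPoint d L β 0 v k + isingTorusTwoPoint d L β 0 v l) * isingTorusTwoPoint d L β 0 k u ≤
      4 * (((univ.filter ((torusGraph d L).Adj (0 : 𝕋))).card : ℝ) * torusBubble d L β) := by
  have h1 := sum_adj_twoPoint_mul_le_a (d := d) (L := L) β u u
  have h2 := sum_adj_twoPoint_mul_le_b (d := d) (L := L) β u u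
  have h3 := sum_adj_twoPoint_mul_le_a (d := d) (L := L) β v u
  have h4 := sum_adj_twoPoint_mul_le_b (d := d) (L := L) β v u
  have hsplit : ∑ k : 𝕋, ∑ l ∈ univ.filter ((torusGraph d L).Adj k),
      (isingTorusTwoPoint d L β 0 u k + isingTorusTwoPoint d L β 0 u l +
        isingTorusTwoPoint d L β 0 v k + isingTorusTwoPoint d L β 0 v l) * isingTorusTwoPoint d L β 0 k u =
      (∑ k : 𝕋, ∑ _l ∈ univ.filter ((torusGraph d L).Adj k), isingTorusTwoPoint d L β 0 u k * isingTorusTwoPoint d L β 0 k u) +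
      (∑ k : 𝕋, ∑ l ∈ univ.filter ((torusGraph d L).Adj k), isingTorusTwoPoint d L β 0 u l * isingTorusTwoPoint d L β 0 k u) +
      (∑ k : 𝕋, ∑ _l ∈ univ.filter ((torusGraph d L).Adj k), isingTorusTwoPoint d L β 0 v k * isingTorusTwoPoint d L β 0 k u) +
      ∑ k : 𝕋, ∑ l ∈ univ.filter ((torusGraph d L).Adj k), isingTorusTwoPoint d L β 0 v l * isingTorusTwoPoint d L β 0 k u := by
    simp only [← sum_add_distrib]
    exact sum_congr rfl fun k _ => sum_congr rfl fun l _ => by ring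
  rw [hsplit]; linarith

/-- The same with the roles of the two bonds exchanged (for a fixed bond `(k,l)`):
`∑_u ∑_{v∼u} (⟨uk⟩+⟨ul⟩+⟨vk⟩+⟨vl⟩)₀ ⟨ku⟩₀ ≤ 4 deg B_L`. [cite: AizenmanFernandezJSP1986, §5.2, eq. (5.51), p. 441] -/
theorem sum_cross_mul_link_le' (β : ℝ) (k l : 𝕋) :
    ∑ u : 𝕋, ∑ v ∈ univ.filter ((torusGraph d L).Adj u),
        (isingTorusTwoPoint d L β 0 u k + isingTorusTwoPoint d L β 0 u l +
          isingTorusTwoPoint d L β 0 v k + isingTorusTwoPoint d L β 0 v l) * isingTorusTwoPoint d L β 0 k u ≤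
      4 * (((univ.filter ((torusGraph d L).Adj (0 : 𝕋))).card : ℝ) * torusBubble d L β) := by
  have h1 := sum_adj_twoPoint_mul_le_a (d := d) (L := L) β k k
  have h2 := sum_adj_twoPoint_mul_le_a (d := d) (L := L) β l k
  have h3 := sum_adj_twoPoint_mul_le_b (d := d) (L := L) β k k
  have h4 := sum_adj_twoPoint_mul_le_b (d := d) (L := L) β l k
  have hsplit : ∑ u : 𝕋, ∑ v ∈ univ.filter ((torusGraph d L).Adj u),
      (isingTorusTwoPoint d L β 0 u k + isingTorusTwoPoint d L β 0 u l +
        isingTorusTwoPoint d L β 0 v k + isingTorusTwoPoint d L β 0 v l) * isingTorusTwoPoint d L β 0 k u =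
      (∑ u : 𝕋, ∑ _v ∈ univ.filter ((torusGraph d L).Adj u), isingTorusTwoPoint d L β 0 k u * isingTorusTwoPoint d L β 0 u k) +
      (∑ u : 𝕋, ∑ _v ∈ univ.filter ((torusGraph d L).Adj u), isingTorusTwoPoint d L β 0 l u * isingTorusTwoPoint d L β 0 u k) +
      (∑ u : 𝕋, ∑ v ∈ univ.filter ((torusGraph d L).Adj u), isingTorusTwoPoint d L β 0 k v * isingTorusTwoPoint d L β 0 u k) +
      ∑ u : 𝕋, ∑ v ∈ univ.filter ((torusGraph d L).Adj u), isingTorusTwoPoint d L β 0 l v * isingTorusTwoPoint d L β 0 u k := by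
    simp only [← sum_add_distrib]
    refine sum_congr rfl fun u _ => sum_congr rfl fun v _ => ?_
    rw [isingTorusTwoPoint_comm β 0 u k, isingTorusTwoPoint_comm β 0 u l, isingTorusTwoPoint_comm β 0 v k,
      isingTorusTwoPoint_comm β 0 v l]
    ring
  rw [hsplit]; linarith

/-- **The bound on the second-order weight sum**:
`∑_{u,k} W(u,k) ⟨σ_kσ_u⟩₀ [G♭(u,0) + G♭(0,k)] (M/(βh)) ≤ 96 M (M/(βh)+1) (M/(βh))² deg² B_L`
(AM–GM bubble bounds and `∑_u G♭(0,u) ≤ M/(βh)`, ghost-avoiding weak GHS). [cite: AizenmanFernandezJSP1986, §5.2, eqs. (5.50)–(5.52), pp. 440–441] -/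
theorem sum_afW_mul_le {β h : ℝ} (hβ : 0 < β) (hh : 0 < h) :
    ∑ u : 𝕋, ∑ k : 𝕋, afW d L β h u k * (isingTorusTwoPoint d L β 0 k u *
        ((gAvoidZ GT univ (ghostCoupling β (β * h)) u 0).toReal / (ZT[ghostCoupling β (β * h)]).toReal *
            (torusMag d L β h / (β * h)) +
          (gAvoidZ GT univ (ghostCoupling β (β * h)) 0 k).toReal / (ZT[ghostCoupling β (β * h)]).toReal *
            (torusMag d L β h / (β * h)))) ≤
      96 * torusMag d L β h * (torusMag d L β h / (β * h) + 1) * (torusMag d L β h / (β * h)) ^ 2 *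
        ((univ.filter ((torusGraph d L).Adj (0 : 𝕋))).card : ℝ) ^ 2 * torusBubble d L β := by
  set θ : Sym2 (Option 𝕋) → ℝ := ghostCoupling β (β * h) with hθdef
  have hθ : ∀ e, 0 ≤ θ e := fun e => ghostCoupling_nonneg hβ.le (mul_nonneg hβ.le hh.le) e
  set Z : ℝ := (ZT[θ]).toReal with hZ
  have hZpos : 0 < Z := toReal_gcurrentZ_ghost_empty_pos subset_rfl hθ subset_rfl
  set M : ℝ := torusMag d L β h with hMdef
  set s : ℝ := β * h with hsdef
  have hs : 0 < s := mul_pos hβ hh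
  have hM0 : 0 ≤ M := torusMag_nonneg hβ.le hh.le
  set deg : ℝ := ((univ.filter ((torusGraph d L).Adj (0 : 𝕋))).card : ℝ) with hdeg
  have hdeg0 : 0 ≤ deg := Nat.cast_nonneg _
  set B := torusBubble d L β with hBdef
  set G0 : 𝕋 → 𝕋 → ℝ := fun a b => isingTorusTwoPoint d L β 0 a b with hG0
  set Gf : 𝕋 → 𝕋 → ℝ := fun a b => (gAvoidZ GT univ θ a b).toReal / Z with hGf
  have hGf0 : ∀ a b, 0 ≤ Gf a b := fun a b => div_nonneg ENNReal.toReal_nonneg hZpos.le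
  set K : ℝ := 12 * M * (M / s + 1) with hK
  have hK0 : 0 ≤ K := by have : 0 ≤ M / s := div_nonneg hM0 hs.le; positivity
  set cross : 𝕋 → 𝕋 → 𝕋 → 𝕋 → ℝ := fun u v k l => G0 u k + G0 u l + G0 v k + G0 v l with hcross
  -- `∑_u G♭(u,0) ≤ M/s` and `∑_k G♭(0,k) ≤ M/s`
  have hGsum0 : ∑ k : 𝕋, Gf 0 k ≤ M / s := by
    have := sum_gAvoid_le_isingCorr_div (G := GT) (Λ := univ) hβ hh (u := (0 : 𝕋)) (mem_univ _)
    rw [← hθdef] at this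
    have hM' : isingCorr GT univ β h .free {(0 : 𝕋)} = M := by
      rw [hMdef, torusMag_eq_thetaCorr, ← thetaCorr_ghostCoupling]
    rw [hM'] at this
    exact this
  have hGsum1 : ∑ u : 𝕋, Gf u 0 ≤ M / s := by
    refine le_trans (le_of_eq (sum_congr rfl fun u _ => ?_)) hGsum0
    simp only [hGf]; rw [gAvoidZ_comm]
  -- the two halves
  have hWK : ∀ u k : 𝕋, afW d L β h u k * G0 k u = K * ∑ v ∈ univ.filter ((torusGraph d L).Adj u),
      ∑ l ∈ univ.filter ((torusGraph d L).Adj k), cross u v k l * G0 k u := by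
    intro u k
    unfold afW
    rw [sum_mul, mul_sum]
    refine sum_congr rfl fun v _ => ?_
    rw [sum_mul, mul_sum]
    refine sum_congr rfl fun l _ => ?_
    simp only [hK, hcross, hG0]; ring
  have hB0 : 0 ≤ B := le_trans zero_le_one (one_le_torusBubble β)
  have hΦ : ∀ u : 𝕋, ∑ k : 𝕋, afW d L β h u k * G0 k u ≤ K * (deg * (4 * (deg * B))) := by
    intro u
    simp_rw [hWK]
    rw [← mul_sum, sum_comm]
    refine mul_le_mul_of_nonneg_left ?_ hK0
    calc ∑ v ∈ univ.filter ((torusGraph d L).Adj u), ∑ k : 𝕋, ∑ l ∈ univ.filter ((torusGraph d L).Adj k), cross u v k l * G0 k u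
        ≤ ∑ _v ∈ univ.filter ((torusGraph d L).Adj u), 4 * (deg * B) :=
          sum_le_sum fun v _ => sum_cross_mul_link_le β u v
      _ = deg * (4 * (deg * B)) := by rw [sum_const, card_filter_adj_eq u, nsmul_eq_mul]
  have hΨ : ∀ k : 𝕋, ∑ u : 𝕋, afW d L β h u k * G0 k u ≤ K * (deg * (4 * (deg * B))) := by
    intro k
    simp_rw [hWK]
    rw [← mul_sum]
    refine mul_le_mul_of_nonneg_left ?_ hK0
    have hswap : ∑ u : 𝕋, ∑ v ∈ univ.filter ((torusGraph d L).Adj u), ∑ l ∈ univ.filter ((torusGraph d L).Adj k),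
        cross u v k l * G0 k u =
        ∑ l ∈ univ.filter ((torusGraph d L).Adj k), ∑ u : 𝕋, ∑ v ∈ univ.filter ((torusGraph d L).Adj u),
          cross u v k l * G0 k u := by
      rw [sum_comm]
      refine (sum_congr rfl fun u _ => sum_comm).trans ?_
      rw [sum_comm]
    rw [hswap]
    calc ∑ l ∈ univ.filter ((torusGraph d L).Adj k), ∑ u : 𝕋, ∑ v ∈ univ.filter ((torusGraph d L).Adj u), cross u v k l * G0 k u
        ≤ ∑ _l ∈ univ.filter ((torusGraph d L).Adj k), 4 * (deg * B) :=
          sum_le_sum fun l _ => sum_cross_mul_link_le' β k l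
      _ = deg * (4 * (deg * B)) := by rw [sum_const, card_filter_adj_eq k, nsmul_eq_mul]
  -- assemble
  have hsplit : ∑ u : 𝕋, ∑ k : 𝕋, afW d L β h u k * (G0 k u * (Gf u 0 * (M / s) + Gf 0 k * (M / s))) =
      (M / s) * (∑ u : 𝕋, Gf u 0 * ∑ k : 𝕋, afW d L β h u k * G0 k u) +
        (M / s) * ∑ k : 𝕋, Gf 0 k * ∑ u : 𝕋, afW d L β h u k * G0 k u := by
    have h1 : ∑ u : 𝕋, ∑ k : 𝕋, afW d L β h u k * (G0 k u * (Gf u 0 * (M / s) + Gf 0 k * (M / s))) =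
        (∑ u : 𝕋, ∑ k : 𝕋, (M / s) * (Gf u 0 * (afW d L β h u k * G0 k u))) +
          ∑ u : 𝕋, ∑ k : 𝕋, (M / s) * (Gf 0 k * (afW d L β h u k * G0 k u)) := by
      rw [← sum_add_distrib]
      refine sum_congr rfl fun u _ => ?_
      rw [← sum_add_distrib]
      exact sum_congr rfl fun k _ => by ring
    rw [h1]
    congr 1
    · rw [mul_sum]
      refine sum_congr rfl fun u _ => ?_
      rw [mul_sum, mul_sum]
    · rw [sum_comm, mul_sum]
      refine sum_congr rfl fun k _ => ?_
      rw [mul_sum, mul_sum]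
  change ∑ u : 𝕋, ∑ k : 𝕋, afW d L β h u k * (G0 k u * (Gf u 0 * (M / s) + Gf 0 k * (M / s))) ≤
    96 * M * (M / s + 1) * (M / s) ^ 2 * deg ^ 2 * B
  rw [hsplit]
  have hMs0 : 0 ≤ M / s := div_nonneg hM0 hs.le
  have hT1 : ∑ u : 𝕋, Gf u 0 * ∑ k : 𝕋, afW d L β h u k * G0 k u ≤ (M / s) * (K * (deg * (4 * (deg * B)))) := by
    calc ∑ u : 𝕋, Gf u 0 * ∑ k : 𝕋, afW d L β h u k * G0 k u ≤ ∑ u : 𝕋, Gf u 0 * (K * (deg * (4 * (deg * B)))) :=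
          sum_le_sum fun u _ => mul_le_mul_of_nonneg_left (hΦ u) (hGf0 u 0)
      _ = (∑ u : 𝕋, Gf u 0) * (K * (deg * (4 * (deg * B)))) := by rw [sum_mul]
      _ ≤ (M / s) * (K * (deg * (4 * (deg * B)))) := mul_le_mul_of_nonneg_right hGsum1 (by positivity)
  have hT2 : ∑ k : 𝕋, Gf 0 k * ∑ u : 𝕋, afW d L β h u k * G0 k u ≤ (M / s) * (K * (deg * (4 * (deg * B)))) := by
    calc ∑ k : 𝕋, Gf 0 k * ∑ u : 𝕋, afW d L β h u k * G0 k u ≤ ∑ k : 𝕋, Gf 0 k * (K * (deg * (4 * (deg * B)))) :=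
          sum_le_sum fun k _ => mul_le_mul_of_nonneg_left (hΨ k) (hGf0 0 k)
      _ = (∑ k : 𝕋, Gf 0 k) * (K * (deg * (4 * (deg * B)))) := by rw [sum_mul]
      _ ≤ (M / s) * (K * (deg * (4 * (deg * B)))) := mul_le_mul_of_nonneg_right hGsum0 (by positivity)
  have h96 : (M / s) * ((M / s) * (K * (deg * (4 * (deg * B))))) + (M / s) * ((M / s) * (K * (deg * (4 * (deg * B))))) =
      96 * M * (M / s + 1) * (M / s) ^ 2 * deg ^ 2 * B := by simp only [hK]; ring
  nlinarith [mul_le_mul_of_nonneg_left hT1 hMs0, mul_le_mul_of_nonneg_left hT2 hMs0]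

/-! ### Torus facts: degree bounds, weak GHS -/

/-- **`deg ≤ 2d`**: every neighbour of `0` is `±e_i`. [cite: FriedliVelenik2017, §3.1 (periodic boundary condition)] -/
theorem card_filter_adj_zero_le : #(univ.filter ((torusGraph d L).Adj (0 : 𝕋))) ≤ 2 * d := by
  classical
  have hsub : univ.filter ((torusGraph d L).Adj (0 : 𝕋)) ⊆
      (univ : Finset (Fin d)).image (fun i => (Pi.single i 1 : 𝕋)) ∪
        (univ : Finset (Fin d)).image (fun i => -(Pi.single i 1 : 𝕋)) := by
    intro y hy
    have hadj := (mem_filter.1 hy).2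
    rcases (torusGraph_adj_iff (0 : 𝕋) y).1 hadj with ⟨-, ⟨i, hi⟩ | ⟨i, hi⟩⟩
    · exact mem_union_left _ (mem_image.2 ⟨i, mem_univ _, by rw [hi, zero_add]⟩)
    · refine mem_union_right _ (mem_image.2 ⟨i, mem_univ _, ?_⟩)
      have : y = -(Pi.single i 1 : 𝕋) := by
        have h0 : (0 : 𝕋) = y + Pi.single i 1 := hi
        exact eq_neg_of_add_eq_zero_left h0.symm
      rw [this]
  refine (card_le_card hsub).trans ((card_union_le _ _).trans ?_)
  have h1 : #((univ : Finset (Fin d)).image (fun i => (Pi.single i 1 : 𝕋))) ≤ d :=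
    card_image_le.trans (by simp)
  have h2 : #((univ : Finset (Fin d)).image (fun i => -(Pi.single i 1 : 𝕋))) ≤ d :=
    card_image_le.trans (by simp)
  omega

/-- **`1 ≤ deg`** for `d ≥ 1`, `L ≥ 2`: `e_0` is a neighbour of `0`. [cite: FriedliVelenik2017, §3.1 (periodic boundary condition)] -/
theorem one_le_card_filter_adj_zero (hd : 1 ≤ d) (hL : 2 ≤ L) : 1 ≤ #(univ.filter ((torusGraph d L).Adj (0 : 𝕋))) := by
  classical
  have h10 : (1 : ZMod L) ≠ 0 := by
    intro h0
    have := congrArg ZMod.val h0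
    rw [ZMod.val_one'' (by omega : L ≠ 1), ZMod.val_zero] at this
    exact one_ne_zero this
  set i0 : Fin d := ⟨0, hd⟩
  set y : 𝕋 := Pi.single i0 1 with hy
  have hy0 : y ≠ 0 := fun h0 => by
    have := congrFun h0 i0
    rw [hy, Pi.single_eq_same] at this
    exact h10 this
  have hadj : (torusGraph d L).Adj 0 y := (torusGraph_adj_iff (0 : 𝕋) y).2 ⟨hy0.symm, Or.inl ⟨i0, by rw [zero_add]⟩⟩
  exact card_pos.2 ⟨y, mem_filter.2 ⟨mem_univ _, hadj⟩⟩

/-- **Weak GHS on the torus**: `βh · χ_L ≤ M_L`. [cite: FernandezFrohlichSokalSpringer1992, §12.2, "weak GHS" inequality; AizenmanFernandezJSP1986, §5.2, (5.50)] -/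
theorem mul_torusSusc_le_torusMag {β h : ℝ} (hβ : 0 ≤ β) (hh : 0 ≤ h) :
    β * h * torusSusc d L β h ≤ torusMag d L β h := by
  have hθ : ∀ e, 0 ≤ (ghostCoupling β (β * h) : Sym2 (Option 𝕋) → ℝ) e :=
    fun e => ghostCoupling_nonneg hβ (mul_nonneg hβ hh) e
  have h1 := thetaCorr_sum_field_trunc_le (G := GT) (Λ := univ) hθ (a := (0 : 𝕋)) (mem_univ _)
  simp only [ghostCoupling_ghostEdge] at h1
  rw [← mul_sum, ← torusSusc_eq_sum_thetaCorr, ← torusMag_eq_thetaCorr] at h1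
  exact h1

/-! ### Theorem 5.7(b): the restricted differential inequality from Theorem 5.6 -/

/-- **The optimisation in the dilution parameter** (Aizenman–Fernández's "interpolated bound"
(5.53)): if `2(pC₁ - p²C₂) ≤ U` for all `p ∈ [0,1]` with `C₁ ≥ cχ³M`, `C₂ ≤ c'M(M/s+1)(M/s)²`, and
`sχ ≤ M ≤ 33 sχ`, `2s ≤ M`, then `κ s χ⁴ ≤ U` for `κ = min(c, c²/(3267c'))`. [cite: AizenmanFernandezJSP1986, §5.2, eq. (5.53) and Prop. 5.1 (5.2), pp. 424, 441] -/
theorem af_optimise {U s χ M c c' κ : ℝ} (hs : 0 < s) (hχ : 0 < χ) (hc : 0 < c) (hc' : 0 < c')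
    (hκc : κ ≤ c) (hκ' : 3267 * κ * c' ≤ c ^ 2) (hκ0 : 0 < κ) (hsχ : s * χ ≤ M) (hM33 : M ≤ 33 * (s * χ))
    (h2s : 2 * s ≤ M)
    (hkey : ∀ p ∈ Set.Icc (0 : ℝ) 1, 2 * (p * (c * χ ^ 3 * M) - p ^ 2 * (c' * M * (M / s + 1) * (M / s) ^ 2)) ≤ U) :
    κ * s * χ ^ 4 ≤ U := by
  have hM : 0 < s := hs
  have hMpos : 0 < M := by nlinarith
  set C₁ : ℝ := c * χ ^ 3 * M with hC₁
  set C₂ : ℝ := c' * M * (M / s + 1) * (M / s) ^ 2 with hC₂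
  have hC₁0 : 0 < C₁ := by positivity
  have hMs : 0 < M / s := div_pos hMpos hs
  have hC₂0 : 0 < C₂ := by positivity
  by_cases hcase : 2 * C₂ ≤ C₁
  · -- `p = 1`
    have h1 := hkey 1 ⟨zero_le_one, le_rfl⟩
    have hlow : κ * s * χ ^ 4 ≤ C₁ := by
      calc κ * s * χ ^ 4 ≤ c * s * χ ^ 4 := by
            have : 0 ≤ s * χ ^ 4 := by positivity
            nlinarith
        _ = c * χ ^ 3 * (s * χ) := by ring
        _ ≤ c * χ ^ 3 * M := mul_le_mul_of_nonneg_left hsχ (by positivity)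
    nlinarith
  · -- `p = C₁/(2C₂)`
    push Not at hcase
    set p : ℝ := C₁ / (2 * C₂) with hp
    have hp0 : 0 ≤ p := div_nonneg hC₁0.le (by positivity)
    have hp1 : p ≤ 1 := by rw [hp, div_le_one (by positivity)]; linarith
    have h1 := hkey p ⟨hp0, hp1⟩
    have hval : 2 * (p * C₁ - p ^ 2 * C₂) = C₁ ^ 2 / (2 * C₂) := by
      simp only [hp]
      field_simp
      ring
    rw [hval] at h1
    refine le_trans ?_ h1
    rw [le_div_iff₀ (by positivity)]
    -- `κ s χ⁴ · 2C₂ ≤ C₁²`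
    have hMM : M * (M + s) ≤ 3 / 2 * (33 * (s * χ)) ^ 2 := by nlinarith
    have hE : κ * s * χ ^ 4 * (2 * C₂) = 2 * κ * c' * χ ^ 4 * (M * (M + s)) * (M ^ 2 / s ^ 2) := by
      simp only [hC₂]
      field_simp
    have hC₁sq : C₁ ^ 2 = c ^ 2 * χ ^ 6 * M ^ 2 := by simp only [hC₁]; ring
    rw [hE, hC₁sq]
    have hstep : 2 * κ * c' * χ ^ 4 * (M * (M + s)) * (M ^ 2 / s ^ 2) ≤
        2 * κ * c' * χ ^ 4 * (3 / 2 * (33 * (s * χ)) ^ 2) * (M ^ 2 / s ^ 2) :=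
      mul_le_mul_of_nonneg_right (mul_le_mul_of_nonneg_left hMM (by positivity)) (by positivity)
    refine hstep.trans ?_
    have : 2 * κ * c' * χ ^ 4 * (3 / 2 * (33 * (s * χ)) ^ 2) * (M ^ 2 / s ^ 2) = (3267 * κ * c') * χ ^ 6 * M ^ 2 := by
      field_simp
      ring
    rw [this]
    exact mul_le_mul_of_nonneg_right (mul_le_mul_of_nonneg_right hκ' (by positivity)) (by positivity)

set_option maxHeartbeats 800000 in
/-- **Aizenman–Fernández's Theorem 5.7(b) on the torus, from Theorem 5.6, in the restricted shape
form**: if the periodic models satisfy (5.19)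
(`∂M/∂β ≥ deg χ [M - tanh(βh) B_L]₊ / (1 + 2β deg B_L)`, `torusDbeta`), then for `d ≥ 5` there are
`β₀ < β_c`, `h₀, κ, a > 0`, `B ≥ 0` such that for `β₀ < β < β_c`, `L ≥ L₀(β)`, `0 < h ≤ h₀`, on
`{B βh ≤ a M_L, M_L ≤ 33 βh χ_L}`: `ū₃,L ≤ -κ βh χ_L⁴` — the hypothesis of
`spontaneousMagnetization_le_sqrt_of_torusShapeR`. [cite: AizenmanFernandezJSP1986, §5.2, Thm. 5.7(b), eqs. (5.33)–(5.53), pp. 435–441] -/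
theorem torusShapeR_of_torusDbeta
    (h56 : ∀ {d L : ℕ} [NeZero L] {β h : ℝ}, 3 ≤ L → 0 < β → β < criticalBeta d → 0 < h →
      ((univ.filter ((torusGraph d L).Adj (0 : TorusSite d L))).card : ℝ) * torusSusc d L β h *
            max (torusMag d L β h - Real.tanh (β * h) * torusBubble d L β) 0 /
          (1 + 2 * β * ((univ.filter ((torusGraph d L).Adj (0 : TorusSite d L))).card : ℝ) * torusBubble d L β) ≤
        torusDbeta d L β h) :
    ∀ ⦃d : ℕ⦄, 5 ≤ d → ∃ β₀ h₀ κ a B : ℝ, β₀ < criticalBeta d ∧ 0 < h₀ ∧ 0 < κ ∧ 0 < a ∧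
      0 ≤ B ∧ ∀ β ∈ Set.Ioo β₀ (criticalBeta d), 0 < β → ∃ L₀ : ℕ, ∀ L : ℕ, L₀ ≤ L →
        ∀ [NeZero L], ∀ h ∈ Set.Ioc (0 : ℝ) h₀, B * (β * h) ≤ a * torusMag d L β h →
          torusMag d L β h ≤ 33 * ((β * h) * torusSusc d L β h) →
          torusU3 d L β h ≤ -(κ * (β * h) * torusSusc d L β h ^ 4) := by
  intro d hd
  obtain ⟨Bb, hBb1, hBb⟩ := exists_torusBubble_le hd
  have hβc : 0 < criticalBeta d := criticalBeta_pos_holds (d := d) (by omega)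
  have hBb0 : 0 < Bb := by linarith
  -- constants
  set βc := criticalBeta d with hβcdef
  set c : ℝ := (βc / 2) / (2 * (1 + 4 * d * βc * Bb)) with hcdef
  set c' : ℝ := 768 * βc ^ 2 * d ^ 2 * Bb with hc'def
  have hden : 0 < 1 + 4 * (d : ℝ) * βc * Bb := by positivity
  have hc0 : 0 < c := by positivity
  have hd0 : 0 < (d : ℝ) := by exact_mod_cast (show 0 < d by omega)
  have hc'0 : 0 < c' := by positivity
  set κ : ℝ := min c (c ^ 2 / (3267 * c')) with hκdef
  have hκ0 : 0 < κ := lt_min hc0 (by positivity)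
  have hκc : κ ≤ c := min_le_left _ _
  have hκ' : 3267 * κ * c' ≤ c ^ 2 := by
    have : κ ≤ c ^ 2 / (3267 * c') := min_le_right _ _
    rw [le_div_iff₀ (by positivity)] at this
    linarith
  refine ⟨βc / 2, 1, κ, 1, 2 * Bb, by linarith, one_pos, hκ0, one_pos, by linarith, ?_⟩
  intro β hβI hβ
  obtain ⟨L₀, hL₀⟩ := hBb β hβ.le hβI.2
  refine ⟨max L₀ 3, fun L hL => ?_⟩
  intro _ h hh hE1 hE2
  have hL3 : 3 ≤ L := le_trans (le_max_right _ _) hL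
  have hBL : torusBubble d L β ≤ Bb := hL₀ L (le_trans (le_max_left _ _) hL)
  have hBL1 : 1 ≤ torusBubble d L β := one_le_torusBubble β
  have hh0 : 0 < h := hh.1
  set s : ℝ := β * h with hsdef
  have hs : 0 < s := mul_pos hβ hh0
  set M := torusMag d L β h with hMdef
  set χ := torusSusc d L β h with hχdef
  set deg : ℝ := ((univ.filter ((torusGraph d L).Adj (0 : TorusSite d L))).card : ℝ) with hdegdef
  have hdeg1 : 1 ≤ deg := by
    rw [hdegdef]; exact_mod_cast one_le_card_filter_adj_zero (d := d) (L := L) (by omega) (by omega)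
  have hdeg2 : deg ≤ 2 * d := by
    rw [hdegdef]; exact_mod_cast card_filter_adj_zero_le (d := d) (L := L)
  have hM0 : 0 ≤ M := torusMag_nonneg hβ.le hh0.le
  have hχ0 : 0 < χ := torusSusc_pos hβ.le hh0.le
  have hsχ : s * χ ≤ M := mul_torusSusc_le_torusMag hβ.le hh0.le
  have h2s : 2 * s ≤ M := by
    have : 2 * Bb * (β * h) ≤ 1 * M := hE1
    nlinarith
  have hM33 : M ≤ 33 * (s * χ) := hE2
  have hD0 : 0 ≤ torusDbeta d L β h := torusDbeta_nonneg hβ.le hh0.le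
  -- Theorem 5.6 on the event: `torusDbeta ≥ deg χ (M/2) / (1 + 2β deg B_L)`
  have h56' : deg * χ * (M / 2) / (1 + 2 * β * deg * torusBubble d L β) ≤ torusDbeta d L β h := by
    have h1 := h56 (d := d) (L := L) hL3 hβ hβI.2 hh0
    rw [← hdegdef, ← hMdef, ← hχdef] at h1
    refine le_trans ?_ h1
    have hdenL : 0 < 1 + 2 * β * deg * torusBubble d L β := by
      have : 0 ≤ 2 * β * deg * torusBubble d L β := by positivity
      linarith
    rw [div_le_div_iff_of_pos_right hdenL]
    refine mul_le_mul_of_nonneg_left ?_ (by positivity)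
    refine le_trans ?_ (le_max_left _ _)
    have ht : Real.tanh (β * h) ≤ β * h := Literature.Barriers.HubbardSuperconductivity.tanh_le_self hs.le
    have ht0 : 0 ≤ Real.tanh (β * h) := by
      rw [Real.tanh_eq_sinh_div_cosh]
      exact div_nonneg (Real.sinh_nonneg_iff.2 hs.le) (Real.cosh_pos _).le
    have : Real.tanh (β * h) * torusBubble d L β ≤ s * Bb :=
      mul_le_mul ht hBL (by linarith) hs.le
    have hE1' : 2 * Bb * s ≤ M := by simpa using hE1
    nlinarith
  -- `C₁ ≥ c χ³ M`
  have hC₁ : c * χ ^ 3 * M ≤ β * torusDbeta d L β h * χ ^ 2 := by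
    have hdenL : 0 < 1 + 2 * β * deg * torusBubble d L β := by
      have : 0 ≤ 2 * β * deg * torusBubble d L β := by positivity
      linarith
    have hden_le : 1 + 2 * β * deg * torusBubble d L β ≤ 1 + 4 * d * βc * Bb := by
      have h1 : β * deg * torusBubble d L β ≤ βc * (2 * d) * Bb := by
        have := hβI.2.le
        calc β * deg * torusBubble d L β ≤ βc * deg * torusBubble d L β := by
              refine mul_le_mul_of_nonneg_right (mul_le_mul_of_nonneg_right this (by linarith)) (by linarith)
          _ ≤ βc * (2 * d) * torusBubble d L β := by
              refine mul_le_mul_of_nonneg_right (mul_le_mul_of_nonneg_left hdeg2 hβc.le) (by linarith)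
          _ ≤ βc * (2 * d) * Bb := mul_le_mul_of_nonneg_left hBL (by positivity)
      linarith
    -- `c χ³ M ≤ β deg χ (M/2)/(1+2β deg B_L) · χ²`
    have hlow : c * (χ * M) ≤ β * (deg * χ * (M / 2) / (1 + 2 * β * deg * torusBubble d L β)) := by
      rw [mul_div_assoc', le_div_iff₀ hdenL]
      have hβ0 : βc / 2 ≤ β := hβI.1.le
      have hχM : 0 ≤ χ * M := by positivity
      -- `c (χM) (1 + 2β deg B_L) ≤ c (χM)(1 + 4dβ_c B̄) = (β_c/2)(χM)/2 ≤ β deg χ M/2`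
      calc c * (χ * M) * (1 + 2 * β * deg * torusBubble d L β)
          ≤ c * (χ * M) * (1 + 4 * d * βc * Bb) := mul_le_mul_of_nonneg_left hden_le (by positivity)
        _ = (βc / 2) * (χ * M) / 2 := by simp only [hcdef]; field_simp
        _ ≤ β * deg * (χ * M) / 2 := by
            have : βc / 2 * (χ * M) ≤ β * deg * (χ * M) := by
              refine mul_le_mul_of_nonneg_right ?_ hχM
              calc βc / 2 ≤ β := hβ0
                _ = β * 1 := (mul_one β).symm
                _ ≤ β * deg := mul_le_mul_of_nonneg_left hdeg1 hβ.le
            linarith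
        _ = β * (deg * χ * (M / 2)) := by ring
    calc c * χ ^ 3 * M = χ ^ 2 * (c * (χ * M)) := by ring
      _ ≤ χ ^ 2 * (β * (deg * χ * (M / 2) / (1 + 2 * β * deg * torusBubble d L β))) :=
          mul_le_mul_of_nonneg_left hlow (by positivity)
      _ ≤ χ ^ 2 * (β * torusDbeta d L β h) := mul_le_mul_of_nonneg_left (mul_le_mul_of_nonneg_left h56' hβ.le) (by positivity)
      _ = β * torusDbeta d L β h * χ ^ 2 := by ring
  -- `C₂ ≤ c' M (M/s+1)(M/s)²`
  have hC₂ : 192 * β ^ 2 * deg ^ 2 * torusBubble d L β * (M * (M / s + 1) * (M / s) ^ 2) ≤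
      c' * M * (M / s + 1) * (M / s) ^ 2 := by
    have hq : 0 ≤ M * (M / s + 1) * (M / s) ^ 2 := by
      have : 0 ≤ M / s := div_nonneg hM0 hs.le
      positivity
    have h1 : 192 * β ^ 2 * deg ^ 2 * torusBubble d L β ≤ c' := by
      have hβ2 : β ^ 2 ≤ βc ^ 2 := pow_le_pow_left₀ hβ.le hβI.2.le 2
      have hdeg2' : deg ^ 2 ≤ (2 * d) ^ 2 := pow_le_pow_left₀ (by linarith) hdeg2 2
      calc 192 * β ^ 2 * deg ^ 2 * torusBubble d L β ≤ 192 * βc ^ 2 * (2 * d) ^ 2 * Bb := by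
            have := mul_le_mul hβ2 hdeg2' (by positivity) (by positivity)
            have := mul_le_mul this hBL (by linarith) (by positivity)
            nlinarith
        _ = c' := by simp only [hc'def]; ring
    calc 192 * β ^ 2 * deg ^ 2 * torusBubble d L β * (M * (M / s + 1) * (M / s) ^ 2)
        ≤ c' * (M * (M / s + 1) * (M / s) ^ 2) := mul_le_mul_of_nonneg_right h1 hq
      _ = c' * M * (M / s + 1) * (M / s) ^ 2 := by ring
  -- the key inequality for every `p`
  have hkey : ∀ p ∈ Set.Icc (0 : ℝ) 1,
      2 * (p * (c * χ ^ 3 * M) - p ^ 2 * (c' * M * (M / s + 1) * (M / s) ^ 2)) ≤ -torusU3 d L β h := by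
    intro p hp
    have h1 := neg_torusU3_ge (d := d) (L := L) hβ hh0 hp.1 hp.2
    have h2 := sum_afW_mul_le (d := d) (L := L) hβ hh0 (β := β) (h := h)
    rw [← hsdef, ← hMdef, ← hdegdef] at h2
    have h3 : 4 * p ^ 2 * β ^ 2 * (96 * M * (M / s + 1) * (M / s) ^ 2 * deg ^ 2 * torusBubble d L β) =
        2 * (p ^ 2 * (192 * β ^ 2 * deg ^ 2 * torusBubble d L β * (M * (M / s + 1) * (M / s) ^ 2))) := by ring
    have hp2 : 0 ≤ p ^ 2 := sq_nonneg p
    have h4 := mul_le_mul_of_nonneg_left h2 (show 0 ≤ 4 * p ^ 2 * β ^ 2 by positivity)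
    have h5 := mul_le_mul_of_nonneg_left hC₁ hp.1
    have h6 := mul_le_mul_of_nonneg_left hC₂ hp2
    rw [← hsdef, ← hMdef, ← hχdef] at h1
    nlinarith [h1, h4, h5, h6, h3]
  have hfin := af_optimise hs hχ0 hc0 hc'0 hκc hκ' hκ0 hsχ hM33 h2s hkey
  linarith

/-- **`δ ≥ 3`, i.e. `M(β) ≤ C (β - β_c)^{1/2}` for `d > 4`, from Aizenman–Fernández's Theorem 5.6
on the tori** (the remaining input being the random-walk kernel of AF86 §4 with Lemma 5.5 and
Prop. 4.7, which gives (5.19) through `torusDbeta_ge_of_kernel`). [cite: AizenmanFernandezJSP1986, §1, (1.9), (1.16) and Cor. after Thm. 5.8 ("for d > 4 … β̂ = 1/2"); §5.2, Thms. 5.6–5.7] [cite: AizenmanBarskyFernandezJSP1987, §1, Table I] -/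
theorem spontaneousMagnetization_le_sqrt_of_af56Torus
    (h56 : ∀ {d L : ℕ} [NeZero L] {β h : ℝ}, 3 ≤ L → 0 < β → β < criticalBeta d → 0 < h →
      ((univ.filter ((torusGraph d L).Adj (0 : TorusSite d L))).card : ℝ) * torusSusc d L β h *
            max (torusMag d L β h - Real.tanh (β * h) * torusBubble d L β) 0 /
          (1 + 2 * β * ((univ.filter ((torusGraph d L).Adj (0 : TorusSite d L))).card : ℝ) * torusBubble d L β) ≤
        torusDbeta d L β h) :
    spontaneousMagnetization_le_sqrt :=
  spontaneousMagnetization_le_sqrt_of_torusShapeR (torusShapeR_of_torusDbeta h56)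

end TorusAF57

end Literature.Probability.LatticeModels
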